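/-
Copyright: cell `langlands-arthur-audit` (papers/Langlands/langlands-arthur-audit), unit `pub-arthur-down-g30`
(downstream tracer, gen 30).  Seventeenth file of the downstream register (module M169 of the cell's MODULE-MAP): `Downstream.lean`
(tranches 1–4) … `Downstream15.lean` (59–61), `Downstream16.lean` (62–63; 75 % of the gate's 200 000-byte file cap) are full or nearly
so, so the register continues here, APPEND-ONLY in the same conventions and the same namespace `…Arthur2013.Downstream`; v1 = the
sixty-fourth tranche (`Consumers64`: THE GALOIS SIDE, II — L. Clozel – J. A. Thorne, Duke Math. J. 166 (2017) (row C29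
`ClozelThorneIII`: Sym⁶ and Sym⁸ of classical modular forms through level-raising on definite unitary groups in nine / seven variables,
through Mok's memoir, the definite group's stabilisation, Mœglin 2007 = E43 and part II = C177), S. Arias-de-Reyna – L. Dieulefait –
S. W. Shin – G. Wiese, Math. Ann. 361 (2015) (row C171 `ADSWInverseGalois`: PGSp_n(𝔽_{ℓ^d}) / PSp_n(𝔽_{ℓ^d}) as Galois groups over ℚ
through a self-dual cuspidal representation of GL_n built from SO_{n+1} by the book's transfer), S. Patrikis – S. Tang, Math. Z. (2021)
(row C57 `PatrikisTangGSpin`: potential automorphy of GSpin_{2n+1}-valued Galois representations, through the book's descent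
GL_{2n+1} → Sp_{2n} and Kret – Shin = C10), F. Calegari – D. Geraghty, Duke Math. J. 169 (2020) (row C34 `CalegariGeraghtyGSp4`: minimal
modularity lifting for non-regular symplectic representations, whose balancedness step uses Arthur's GSp₄ classification = the book ∧
Gee – Taïbi = A4 and Mok 2014 = C191); `Implications64`; bookkeeping theorems); v2 (same unit) = the sixty-fifth tranche (`Consumers65`: THE
GALOIS SIDE, III — S. Patrikis, Mem. AMS 258 (2019) no. 1238 (row C176 `PatrikisTate`: descent of self-dual cuspidal π ↔ ρ of GL_{2n+1} to
Sp_{2n} and geometric lifts to GSpin_{2n+1}, through the book), K. Magaard – G. Savin, J. Algebra 561 (2020) (row C51 `MagaardSavinG2`: G_2(p) as a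
Galois group over ℚ through the book's lift Sp_6 → GL_7), A. Caraiani – M. Tamiozzo, Compos. Math. 159 (2023) (row C45 `CaraianiTamiozzoTorsion`:
torsion Galois representations for Hilbert modular varieties through Scholze = C12, « conditional on Arthur's work » in the totally real case),
V. Pilloni – B. Stroh, Ann. Math. Québec 40 (2016) (row C38 `PilloniStrohGalois`: Galois representations for coherent-cohomology eigensystems on
Siegel – Hilbert and quasi-split unitary Shimura varieties, through the book and Mok), D. Jiang – B. Liu – B. Xu, J. reine angew. Math. 765 (2020)
(row C56 `JLXReciprocal`: the reciprocal branching problem by twisted automorphic descent, through the book, its Chapter-9 node for the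
non-quasi-split even orthogonal target groups, and Jiang – Zhang = C16); `Implications65`; bookkeeping theorems); v3 (same unit) = the
sixty-sixth tranche (`Consumers66`: THE UNITARY LINE — FIVE CONSUMERS OF MOK'S MEMOIR — N. Grbac – F. Shahidi, Pacific J. Math. 276 (2015)
(row C58 `GrbacShahidiAsai`: analytic properties of Asai L-functions through Mok's classification of the residual spectrum of U_2n), D. Jiang –
L. Zhang, JEMS 22 (2020) (row C52 `JZUnitaryNonvanishing`: non-vanishing of L(1/2, π × χ) for quasi-split unitary groups of rank ≤ 2 and, under
their hypothesis, in general — through Mok and the generic packets of the non-quasi-split U_{n+2,n}, KMSW's proved scope), A. Ichino, Adv. Math.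
409 (2022) = arXiv:2002.09148 (row C54 `IchinoThetaReal`: theta lifts of discrete series of real unitary groups by a global argument, « conditional
on Arthur's multiplicity formula … announced by Kaletha–Mínguez–Shin–White », i.e. KMSW in full), T. Finis – E. Lapid, Bull. Iranian Math.
Soc. 43 (2017) (row C53 `FinisLapidTWN`: property (TWN+) for quasi-split classical groups through the book's and Mok's transfer to GL(n)),
C. Anastassiades – J. A. Thorne, J. Inst. Math. Jussieu 21 (2022) (row E7 `ATLevelRaising`: level raising for GL_2n of unitary type through
a definite U_2n, the authors proving « the small piece of the endoscopic classification that we need » from Labesse's stabilised base change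
and Mok's local results — Mok ∧ KMSW's node `StabOrdI`, as rows C177 / C29); `Implications66`; bookkeeping theorems).  Nothing of the
first sixteen files is redeclared or changed.
-/
import HarnessLib
import Literature.NumberTheory.Automorphic.Arthur2013.Downstream16

/-!
# Downstream of Arthur (2013), Mok (2015), KMSW (2014): the typed register, seventeenth file (tranches ≥ 64)

**What is reproduced.**  As in the first sixteen files: for published theorems that invoke J. Arthur, *The Endoscopic
Classification of Representations* (AMS Colloq. Publ. 61, 2013) [cite: Arthur2013], C. P. Mok's memoir [cite: Mok2012] or
Kaletha – Mínguez – Shin – White [claim: KalethaMinguezShinWhite2014, under-review], one HYPOTHESIS `E_…` per statement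
quoting the sentences in which the paper invokes them (or invokes an already-typed consumer), recording WHICH leaves and
nodes of the three dependency DAGs the proof consumes; and bookkeeping theorems composing these hypotheses with the packaged
inputs `BookInputs`, `MokInputs`, `KMSWInputs` of `Downstream.lean`.  Quotations are exact substrings of the cell's texts, staged
byte-identically with sha256 under `HOME/pub-arthur-down-g30/primaries/` (`paper:doi-10-1215-00127094-3714971` (C29, corpus PDF text,
53 pp.), `paper:arxiv-1308.2192` (C171, corpus TeX, 15 chunks), `paper:arxiv-1910.03164` (C57, corpus TeX, 32 chunks), `paper:arxiv-1907.08691`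
(C34, corpus TeX, 40 chunks); locators `pNNNN:Ln`).  Bibliography entries are Lean `--` comments, cited by locator.  The census rows
under test: `DOWNSTREAM.md` C29 l.183 `[g2]` (G-ii), C171 l.738 `[g13d]`, C57 l.211 `[g2]` (G-i), C34 l.188 `[g2]` (G-ii); block `[g30d]`
of `DOWNSTREAM3.md` (this tranche).

**Why a sixty-fourth tranche: the Galois side, II.**  Four published Galois-theoretic consumers of the classifications, graded by
the census in 2026-08 but never typed.  Row C29 (Clozel – Thorne, part III, Duke 2017): p0002:L15 "Theorem 1.1 (Theorem 6.1)." p0002:L17 "1. Assume that F is linearly disjoint from Q(ζ5 ). Then Sym6 π exists." p0002:L19 "2. Assume that F is linearly disjoint from Q(ζ7 ). Then Sym8 π exists." p0002:L20-20 "Under similar restrictions on F and π, Sym5 π and Sym7 π were constructed in [CT15]. As a" […] p0002:L22 "Corollary 1.2. Assume F linearly disjoint from Q(ζ35 ), and π classical. Then Symn π exists for n ≤ 8." — the unitary-group machinery is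
Mok's (p0003:L39-41 "We note that as in our earlier paper [CT15], our proofs rely on the work of Mok [Mok15], extending Arthur’s results to unitary groups; and that in turn Mok’s results are conditional on the stabilisation of the twisted trace formula. This has now been announced in preprint form by Mœglin and Waldspurger [MW]."): the local packets of U_n (p0008:L30-31 "to the work of Moeglin [Mœg07] and Mok [Mok15] there is a decomposition of Πtemp (Un ) as a disjoint union of sets Πϕ , as ϕ ranges over conjugacy classes of Langlands parameters" […] p0008:L36-39 "which are conjugate orthogonal; see [Mok15, Lemma 2.2.1]. In particular, there is a map Πtemp (Un ) → Πtemp (GLn,E ), with image given by those representations corresponding to conjugate orthogonal parameters. We say that such a representation π of GLn,E is in the image of the stable base change map. The fibres of the map Πtemp (Un ) → Πtemp (GLn,E ) are the L-packets Πϕ ."; Theorem 3.2 « (Mœglin, Mok) » with [Mœg07] = E43), the global multiplicity formula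
(Theorem 3.5 « (Mok) » = [Mok15, Theorem 2.5.2]), and the transfer to the ℝ-anisotropic group G by the stable trace formula and
[CHL11] (Theorems 3.8, 3.10) — the definite unitary group's stabilisation, which the register carries as KMSW's node `StabOrdI` exactly
as for part II (row C177, tranche 18) —, the reductions of §6 being « essentially the same as those of [CT15, §6] » (= C177): ⇐ Mok ∧
StabOrdI ∧ E43 ∧ C177.  Row C171 (Arias-de-Reyna – Dieulefait – Shin – Wiese, Math. Ann. 2015): Theorem 1.1 (p0003:L6-7 "Our main theorem is the following new result for the inverse Galois problem over $\Q$ for symplectic groups." p0003:L9-15 "Theorem 1.1. For any even positive integer $n$ and for any positive integer $d$ there exists a set of rational primes of positive density such that, for every prime $\ell$ in this set, the group $\PGSp_n(\F_{\ell^d})$ or $\PSp_n(\F_{\ell^d})$ is realised as a Galois group over $\Q$. The corresponding number field ramifies at most at $\ell$ and two more primes, which are independent of $\ell$.") through Theorem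
3.4 (a self-dual cuspidal π on GL_n(𝔸_ℚ) with prescribed local types, lifted from τ on SO_{n+1} by the book's transfer; p0006:L6-7 "As we utilise Arthur's classification for representations of classical groups, our result depends on a few hypotheses which his work depends on. (See Remark (r:hypotheses) below.) The reader may skip to"): ⇐ book,
with the authors' Remark 3.3 naming the twisted stabilisation AND [A24]–[A28].  Row C57 (Patrikis – Tang, Math. Z. 2021): Theorems 1.1 /
1.2 (potential automorphy of GSpin_{2n+1}-valued \bar r and r) — « the deepest inputs … [blggt] … and Arthur's work ( [art13]) »: the
descent of a self-dual cuspidal Π of GL_{2n+1} to Sp_{2n} and the LLC for Sp_{2n}(L^+_w) (Proposition 4.5), then Kret – Shin [ks] = C10: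
⇐ book ∧ C10.  Row C34 (Calegari – Geraghty, Duke 2020): Theorems 1.1 / 1.2 (minimal modularity lifting and R^min = 𝕋_𝔪 for non-regular
ordinary GSp₄-representations); §(balanced-property) uses « the Classification Theorem of [arthur-gsp4] » (Arthur 2004 — routed, as in
tranches 19 – 29, to the book ∧ A4 Gee – Taïbi, to whom the authors themselves « direct the reader … for the most up to date status ») and
[Mok] = Mok, Compositio 2014 = C191 for the archimedean packet: ⇐ book ∧ A4 ∧ C191.  THE POINT FOR THE CENSUS (kernel,
`DownstreamSupport7.lean` §67, to follow): support(C29) = Mok 29 ∪ KMSW's StabOrdI suppliers (FL, WFL_split, WFL_general, STF, Transfer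
of KMSW's DAG) ∪ the book's five published leaves under E43 — no open book leaf; support(C171) = support(C57) = support(C34) = the book's 24
leaves.  Conditionality wording: C29 EXPLICIT (G-ii: STTF named, « announced in preprint form by Mœglin and Waldspurger »), C171 EXPLICIT
and COMPLETE for its date (Remark 3.3: STTF + « a few expected technical results » + « [A24]-[A28] … in preparation » — G-vii-class
precision), C57 NONE (G-i), C34 EXPLICIT, dated, deferring to A4 (G-ii).  NOT TYPED this tranche: row C172 (Thorne, Forum Math. Sigma
2 (2014) e16): the held text (`paper:doi-10-1017-fms-2014-14`, S2ORC layer) drops the displayed statements of its Theorems 1.1 / 7.1, so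
no verbatim statement is available; its dependence sentence (Proposition 2.4 ⇐ [CT, Prop. 2.9] ⇐ [Mok]) is recorded in `GAPS.md`.

**v2: why a sixty-fifth tranche — the Galois side, III.**  Five more published consumers over number fields, graded by the census, never
typed.  Row C176 (Patrikis, Mem. AMS 2019; preprint 2012 citing the book as « preprint »): Lemma 8.0.7 (p0040:L30-31 "Lemma 8.0.7. Let $\rho \longleftrightarrow \pi$ be as in Lemma (cashin1). Then $\pi$ descends to a cuspidal automorphic representation on $\mr{Sp}_{2n}/F'$.") with Proposition 8.0.8 and the
construction of §8 (p0041:L30 "The construction of geometric $\rho \colon \gal{F} \to \mr{SO}_{2n+1}(\Qlb)$ having no geometric lift to $\mr{GSpin}_{2n+1}(\Qlb)$ (and with specified local behavior) follows as in Lemma (limmult), applying Clozel's limit multiplicity formula to $G= \mr{Sp}_{2n}/F$, transferring these forms to $\mr{GL}_{2n+1}$ (via [arthur:classical]), and then invoking the Paris Book Project, or, more precisely, Remark $7.6$ of [shin:galoisreps]."): ⇐ book.  Row C51 (Magaard – Savin, J. Algebra 2020): p0011:L2 "Applying Theorem (main2) and Proposition (P:tempered) yields the following result:" p0011:L4 "Theorem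 8.3. There exists an extension of $\bbQ$ with $G_2(p)$ as the Galois group, unramified at $5$ and $p$ only, for a set of primes $p$ of density at least $1/18$." through Proposition 8.2 (the book's Theorems 1.5.1 /
1.5.2, formula (1.5.1) and Lemma 7.1.1 for Sp_{2n}): ⇐ book; no status sentence (G-i).  Row C45 (Caraiani – Tamiozzo, Compos. 2023): Theorem 4 (the
torsion Galois representation \bar ρ_𝔪 of a Hilbert modular variety) deduced from « (a special case of) the main result of [sch15] » = row C12
`Consumers.ScholzeTR`, with the authors' own sentence « at the time of writing, the totally real case of the latter is conditional on Arthur's work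
[ar13] »: ⇐ book ∧ C12.  Row C38 (Pilloni – Stroh, Ann. Math. Québec 2016): Remarque 0.2 with Corollaires 3.12 (Sp_2g over a totally real field:
[A]) and 3.13 (« Cas unitaire quasi-déployé »: [Mo]); the status sentence names [A], [Mo], [KMSW] as « conditionnelles à la stabilisation de la
formule des traces tordue » — [KMSW] is named for « un groupe unitaire sur un corps CM » but §3.12.1 restricts to the quasi-split case, so the typed
edge is ⇐ book ∧ Mok (declared).  Row C56 (Jiang – Liu – Xu, Crelle 2020): Theorem 1.2 — the descent target G_{n+1,β} = SO_{2n+2,β} « could be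
either $F$-split, quasi-split or non-quasi-split », and part (c) places each π_β^(i) in a global Arthur packet by « the endoscopic classification of
Arthur ( [A]) »: for the non-quasi-split pure inner forms this is the book's Chapter-9 volume, the register's node `Consumers8.InnerTwists`; the
non-vanishing of L(1/2, φ^(i) × φ_τ0) is « Theorem 5.7 of [JZ15] » = row C16 `Consumers8.JZmain` (hypothesis-on-π form, ⇐ book ∧ Mok ∧ KMSW's scope ∧
`InnerTwists`): ⇐ book ∧ `InnerTwists` ∧ C16.  THE POINT FOR THE CENSUS (kernel, supports to follow in the supports file): support(C176) =
support(C51) = book 24; support(C45) = support(C38) = book 24 ∪ Mok 29; support(C56) = book 24 ∪ {Chapter 9} ∪ support(JZmain) = book ∪ Mok ∪ KMSW's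
proved-scope leaves ∪ {Chapter 9}.  Conditionality wording: C176 NONE (bibliography « preprint » only), C51 NONE (G-i), C45 EXPLICIT blanket (G-ii-class:
« conditional on Arthur's work », leaves unnamed), C38 EXPLICIT (G-ii: STTF named, « mais voir les travaux récents de Waldspurger et Moeglin »), C56 NONE
for the book (the hypothesis on σ is explicit; Chapter 9 unflagged).

**v3: why a sixty-sixth tranche — the unitary line: five consumers of Mok's memoir.**  Row C58 (Grbac – Shahidi, PJM 2015): Theorem 4.3
(the Asai L-functions of cuspidal σ on GL_n(𝔸_E): entire / simple poles, non-vanishing for Re s ≥ 1) by comparing Langlands – Shahidi poles of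
Eisenstein series on U_2n with « Mok's endoscopic classification [2015] » of the residual spectrum; status EXPLICIT (G-ii): « Mok's work, as well as
Arthur's, still depends on the stabilization of the twisted trace formula … Hence, our result is also conditional on this stabilization »: ⇐ Mok.
Row C52 (Jiang – Zhang, JEMS 2020): Theorem 1.3 (their non-vanishing conj. for U_{1,1}, U_{2,1}, U_{2,2}; Theorem 5.1 for U_{2,2}) and Theorems 1.5 /
4.4 / 4.6 (all quasi-split unitary groups under their Fourier-coefficient hypothesis for U_{n+2,n}), through « the endoscopic classification of the
discrete spectrum as in [A13], [Mk15], and [KMSW] » — Mok for the quasi-split groups, KMSW's generic packets of the non-quasi-split U_{n+2,n}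
(KMSW's PROVED scope): ⇐ Mok ∧ `κ.Scope`; hypothesis-on-π form, no status sentence.  Row C54 (Ichino, arXiv 2020 = Adv. Math. 2022): Theorem 1.1
(theta lifts of discrete series of U(p, q)), « conditional on Arthur's multiplicity formula for the automorphic discrete spectra of unitary groups
announced by Kaletha–Mínguez–Shin–White [kmsw] … whose proof will be completed in their subsequent work » — the register's `κ.Full` (the K1 flag,
EXPLICIT): ⇐ Mok ∧ `κ.Full`.  Row C53 (Finis – Lapid, 2017): Theorem 3.11 (property (TWN+) for quasi-split classical groups) through Theorem 5.5
« ([MR3135650], [MR3338302]) » = the book's and Mok's transfer to GL; status EXPLICIT and unusually complete (« requires the full force of the stable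
twisted trace formula. Among the prerequisites of Arthur's results are [18 references] »): ⇐ book ∧ Mok.  Row E7 (Anastassiades – Thorne, JIMJ
2022; census class E = explicit AVOIDANCE of the unwritten KMSW sequels): Theorem 1 / Theorem 17 (level raising for RACSDC Π on GL_2n(𝔸_E'))
through a definite U_2n that is an inner, not pure inner, twist: « a proof of the endoscopic classification for groups like $U_{2n}$ … has been
announced by … [Kal14], but a complete proof has not yet appeared. We therefore establish the small piece … using existing references » —
Labesse's stabilised CM base change ([labesse]: the register's KMSW node `StabOrdI`, as for C177 / C29) and Mok's local results (« [Kal14] (a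
convenient restatement of the results of [Mok15]) », the Whittaker normalisation « By [Mok15] »): ⇐ Mok ∧ `StabOrdI`.  THE POINT FOR THE CENSUS
(kernel, supports to follow in `DownstreamSupport8.lean` §69): support(C58) = Mok 29; support(C52) = Mok 29 ∪ KMSW's scope leaves; support(C54)
= Mok 29 ∪ all of KMSW's leaves (sequels included); support(C53) = book 24 ∪ Mok 29; support(E7) = Mok 29 ∪ StabOrdI's five KMSW suppliers — E7
is certified independent of both KMSW sequels, as its authors intend.

**Deliberately not here.**  Any claim about the content or truth of a Galois representation, a lifting theorem or a
multiplicity; Taylor – Wiles – Kisin patching, BLGGT / Calegari – Emerton – Gee potential automorphy, Harris – Taylor / Taylor – Yoshida /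
Shin / Chenevier – Harris Galois representations for GL_n, Labesse's base change and [CHL11], Khare – Larsen – Savin, Shin's
equidistribution, higher Hida theory and Lan – Suh vanishing: published and Arthur-free, absorbed; no Mathlib, no `axiom`, no `sorry`,
no `opaque`.  Bib keys ClozelThorne2017III, AriasDeReynaDieulefaitShinWiese2015, PatrikisTang2022GSpin, CalegariGeraghty2020Nonregular
added by this unit; ClozelThorne2015 (C177), Moeglin2007Unitary (E43), GeeTaibi2019 (A4), Mok2014Compositio (C191), KretShin2022 (C10),
Arthur2013, Mok2012 exist.
-/

set_option autoImplicit false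

namespace Literature.NumberTheory.Automorphic.Arthur2013

namespace Downstream

/-! ## Sixty-fourth tranche (v1, unit `pub-arthur-down-g30`): THE GALOIS SIDE, II — C29 `ClozelThorneIII`, C171 `ADSWInverseGalois`,
C57 `PatrikisTangGSpin`, C34 `CalegariGeraghtyGSp4`

Context (`DOWNSTREAM.md` rows C29 l.183, C34 l.188, C57 l.211 `[g2]`, C171 l.738 `[g13d]` — never typed; typed premises reused:
`Consumers18.ClozelThorne2` (row C177, tranche 18: Clozel – Thorne II ⇐ Mok ∧ `StabOrdI`), `Consumers45.MoeglinUnitaryDS` (row E43,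
tranche 45 ⇐ five published leaves), `Consumers.KretShinGSp` (row C10, tranche 1 ⇐ book ∧ A7), `Consumers.GeeTaibi` (row A4, tranche 1
⇐ book ∧ the similitude stabilisations), `Consumers28.MokGSp4` (row C191, tranche 28 ⇐ book ∧ A4); block `[g30d]` of
`DOWNSTREAM3.md`.  Loci: C29 p0002:L15-22, p0003:L39-41, p0008:L30-39, p0009:L87-88, p0018:L62-69, p0020:L76-80, p0022:L90-103, p0027:L38,
p0029:L44-46, p0031:L4-5, L44-47, p0033:L10-11, p0044:L52-58, p0050–p0052; C171 p0003:L6-15, p0006:L6-7, p0007:L19-57, p0008:L22-69,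
p0009:L1-6, p0015:L7, L17; C57 p0002:L3, p0003:L7-20, p0004:L3, L36, L40-41, p0013:L16-37, p0020:L9, p0031; C34 p0002:L9-11, L77-84,
p0005:L1-6, p0021:L86-88, p0027:L109-110, p0028:L1-3, L70-80, p0039:L5, L7, L51, p0040:L23. -/

/-- Rows C29, C171, C57, C34 of the census, as an arbitrary assignment of propositions; nothing about the content of a field is assumed. [cite: Arthur2013, downstream register of the cell, sixty-fourth tranche (structure only)] -/
structure Consumers64 where
  /-- C29 (census grade G-ii): Laurent Clozel – Jack A. Thorne, *Level-raising and symmetric power functoriality, III*, Duke Math. J. 166 (2017) no. 2, 325–402, doi:10.1215/00127094-3714971 (corpus PDF text `paper:doi-10-1215-00127094-3714971`, 53 pp.; F totally real, π a RAESDC automorphic representation of GL_2(𝔸_F) not automorphically induced) — THEOREM 1.1 = THEOREM 6.1: p0002:L15 "Theorem 1.1 (Theorem 6.1)." p0002:L17 "1. Assume that F is linearly disjoint from Q(ζ5 ). Then Sym6 π exists." p0002:L19 "2. Assume that F is linearly disjoint from Q(ζ7 ). Then Sym8 π exists." p0002:L20-20 "Under similar restrictions on F and π, Sym5 π and Sym7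 π were constructed in [CT15]. As a" […] p0002:L22 "Corollary 1.2. Assume F linearly disjoint from Q(ζ35 ), and π classical. Then Symn π exists for n ≤ 8." / p0044:L52-57 "Theorem 6.1. Let F be a totally real field, and let (π, χ) be a RAESDC automorphic representation of GL2 (AF ) which is not automorphically induced from a quadratic CM extension. Then: 1. Suppose that F ∩Q(ζ5 ) = Q. Then the 6th symmetric power lifting of π exists, as a cuspidal automorphic representation of GL7 (AF ). 2. Suppose that F ∩Q(ζ7 ) = Q. Then the 8th symmetric power lifting of π exists, as a cuspidal automorphic representation of GL9 (AF )." p0044:L58 "By a series of reductions which are essentially the same as those of [CT15, §6], it is enough to prove" […] [cite: ClozelThorne2017III, Thm 1.1 (p0002:L15-22) = Thm 6.1 (p0044:L52-58)] -/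
  ClozelThorneIII : Prop
  /-- C171 (census grade: explicit and complete flag): Sara Arias-de-Reyna – Luis Dieulefait – Sug Woo Shin – Gabor Wiese, *Compatible systems of symplectic Galois representations and the inverse Galois problem III. Automorphic construction of compatible systems with suitable local properties*, Math. Ann. 361 (2015) 909–925, doi:10.1007/s00208-014-1091-x = arXiv:1308.2192 (corpus TeX `paper:arxiv-1308.2192`, 15 chunks) — THEOREM 1.1: p0003:L6-7 "Our main theorem is the following new result for the inverse Galois problem over $\Q$ for symplectic groups." p0003:L9-15 "Theorem 1.1. For any even positive integer $n$ and for any positive integer $d$ there exists a set of rational primes of positive density such that, for every prime $\ell$ in this set, the group $\PGSp_n(\F_{\ell^d})$ or $\PSp_n(\F_{\ell^d})$ is realised as a Galois group over $\Q$. The corresponding number field ramifies at most at $\ell$ and two more primes, which are independent of $\ell$." through THEOREM 3.4 (the automorphic input): p0008:L40-41 "Theorem 3.4. There exists a cuspidal automorphic representation $\pi$ of $\GL_{n}(\A_\Q)$ such that" p0008:L43 "* $\pi$ is unramified away from $q$ and $t$," p0008:L45 "* $ \rec_q(\pi_q)\simeq \WD(\rho_q)$," […] p0008:L53 "* the central character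 of $\pi$ is trivial." p0008:L55 "As we rely on Arthur's work [Arthur], our theorem is conditional as explained in Remark (r:hypotheses)." PROOF: p0008:L69-69 "Then the functorial lift $\pi$ of $\tau$ as in (sub:Arthur) has the desired properties ((item:i))–((item:v))" […] [cite: AriasDeReynaDieulefaitShinWiese2015, Thm 1.1 (p0003:L6-15), Thm 3.4 (p0008:L40-69)] -/
  ADSWInverseGalois : Prop
  /-- C57 (census grade G-i): Stefan Patrikis – Shiang Tang, *Potential automorphy of GSpin_{2n+1}-valued Galois representations*, Math. Z. (2021), doi:10.1007/s00209-021-02845-0 = arXiv:1910.03164 (corpus TeX `paper:arxiv-1910.03164`, 32 chunks; F^+ totally real) — ABSTRACT: p0002:L3 "We prove a potential automorphy theorem for suitable Galois representations $\Gamma_{F^+} \to \mr{GSpin}_{2n+1}(\ov{\mb{F}}_p)$ and $\Gamma_{F^+} \to \mr{GSpin}_{2n+1}(\bQp)$, where $\Gamma_{F^+}$ is the absolute Galois group of a totally real field $F^+$. We also prove results on solvable descent for $\mr{GSp}_{2n}(\mb{A}_{F^+})$ and use these to put representations $\Gamma_{F^+} \to \mr{GSpin}_{2n+1}(\bQp)$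 into compatible systems of $\mr{GSpin}_{2n+1}(\bQl)$-valued representations." THEOREM 1.1: p0003:L13-14 "Theorem 1.1 (See Theorem (residual aut)). Let $p$ be a prime, $p \geq 2n+4$, and let $\bar{r} \colon \Gamma_{F^+} \to \mr{GSpin}_{2n+1}(\overline{\mb{F}}_p)$ be a continuous representation satisfying the following hypotheses:" p0003:L16 "* The restriction $\op{std}(\bar{r})|_{\Gamma_{F^+(\mu_p)}}$ is irreducible." p0003:L18 "* $\bar{r}$ is odd (see Hypothesis (hypotheses))." p0003:L20 "Then there exist a totally real Galois extension $L^+/F^+$ and a cuspidal automorphic representation $\tilde{\pi}$ of $\mr{GSp}_{2n}(\mb{A}_{L^+})$, satisfying the hypotheses (St) and (L-coh) of [ks], such that a suitable $\mr{GSpin}_{2n+1}$-conjugate of the representation $r_{\tilde{\pi}, \iota} \colon \Gamma_{L^+} \to \mr{GSpin}_{2n+1}(\bQp)$ constructed by [ks] reduces mod $p$ to $\bar{r}|_{\Gamma_{L^+}}$." […] and THEOREM 1.2 (p-adic): p0004:L3 "Theorem 1.2 (Theorem (padicpotaut))." […] p0004:L36 "Then there exist a totally real Galois extension $L^+/F^+$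 and a cuspidal automorphic representation $\tilde{\pi}$ of $\mr{GSp}_{2n}(\mb{A}_{L^+})$ satisfying the hypotheses (St) and (L-coh) of [ks] such that $r_{\tilde{\pi}, \iota}$ is equivalent to $r|_{\Gamma_{L^+}}$ as $\mr{GSpin}_{2n+1}(\bQp)$-representations." […] [cite: PatrikisTang2022GSpin, Thm 1.1 (p0003:L13-20), Thm 1.2 (p0004:L3-36), abstract (p0002:L3)] -/
  PatrikisTangGSpin : Prop
  /-- C34 (census grade G-ii): Frank Calegari – David Geraghty, *Minimal modularity lifting for nonregular symplectic representations*, Duke Math. J. 169 (2020) no. 5, 801–896, doi:10.1215/00127094-2019-0044 = arXiv:1907.08691 (corpus TeX `paper:arxiv-1907.08691`, 40 chunks) — THEOREM 1.1: p0002:L9-11 "Theorem 1.1. Let $r: G_{\Q} \rightarrow \GSp_4(\Qbar_p)$ be a continuous irreducible representation satisfying the following conditions:" […] and THEOREM 1.2 (R^min = 𝕋_𝔪 and freeness): p0002:L77-78 "Theorem 1.2. Suppose that there exists a maximal ideal $\m$ of $\T$" […] p0002:L82-84 "Suppose that $p-1 > j \ge 4$. Then there is an isomorphism $\Rmin \iso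 \T_{\m}$, and moreover, the $\T_{\m}$ module $e H^0(Y_1(N),\omega(j,2) \otimes K/\OL)_{\m}^{\vee}$ is free as a $\T_{\m}$-module." [cite: CalegariGeraghty2020Nonregular, Thm 1.1 (p0002:L9-24), Thm 1.2 (p0002:L77-84)] -/
  CalegariGeraghtyGSp4 : Prop

variable (ν : Nodes) (μ : Mok2015.Nodes) (κ : KMSW2014.Nodes) (c : Consumers) (c₁₃ : Consumers13) (c₁₄ : Consumers14)
  (c₁₈ : Consumers18) (c₁₉ : Consumers19) (c₂₈ : Consumers28) (c₄₃ : Consumers43) (c₄₄ : Consumers44) (c₄₅ : Consumers45)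
  (c₆₄ : Consumers64)

-- Verbatim, the bibliography entries (and nothing else this tranche: no sentence of the four texts naming a conj. is needed in a docstring).
-- C29 (`paper:doi-10-1215-00127094-3714971`): p0050:L8-11 "[Art] James Arthur. The endoscopic classification of representations: orthogonal and symplectic groups. To appear as a Colloquium Publication of the American Mathematical Society." / p0051:L1-4 "[CT15] Laurent Clozel and Jack A. Thorne. Level raising and symmetric power functoriality, II. Ann. of Math. (2), 181(1):303–359, 2015." / p0051:L76-78 "[Lab11] J.-P. Labesse. Changement de base CM et séries discrètes. In On the stabilization of the trace" / p0052:L27-30 "[Mœg07] Colette Mœglin. Classification et changement de base pour les séries discrètes des groupes unitaires p-adiques. Pacific J. Math., 233(1):159–204, 2007." / p0052:L32-35 "[Mok15] Chung Pang Mok. Endoscopic classification of representations of quasi-split unitary groups. Mem. Amer. Math. Soc., 235(1108):vi+248, 2015." / p0052:L37-40 "[MW] Colette Mœglin and Jean-Loup Waldspurger. Stabilisation de la formule des trace tordue I — X. Preprint. Available at http://webusers.imj-prg.fr/∼jean-loup.waldspurger/."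
-- C171 (`paper:arxiv-1308.2192`): p0015:L7 "[Arthur] J.~Arthur, \emph{The endoscopic classification of representations: orthogonal and symplectic groups}, Preprint, \texttt{http://www.claymath.org/cw/arthur/}." / p0015:L17 "[BMM] N.~Bergeron, J.~Millson, and C.~Moeglin, \emph{Hodge type theorems for arithmetic manifolds associated to orthogonal groups}, Preprint, arXiv:1110.3049v2 (2012)."
-- C57 (`paper:arxiv-1910.03164`): p0031:L5 "[art13] Arthur, James. The Endoscopic Classification of Representations Orthogonal and Symplectic Groups. Vol. 61. American Mathematical Soc., 2013." / p0031:L58 "[ks] Kret, Arno and Shin, Sug Woo. Galois representations for general symplectic groups. arXiv preprint <https://arxiv.org/abs/1609.04223> (2016)." / p0031:L9 "[blggt] Barnet-Lamb, Thomas, Toby Gee, David Geraghty and Richard Taylor. Potential automorphy and change of weight, Annals of Mathematics 179.2 (2014): 501-609."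
-- C34 (`paper:arxiv-1907.08691`): p0039:L5 "[arthur-gsp4] James Arthur, \emph{Automorphic representations of {${\rm GSp(4)}$}}, Contributions to automorphic forms, geometry, and number theory, Johns Hopkins Univ. Press, Baltimore, MD, 2004, pp.~65--81. \MR{2058604}" / p0039:L7 "[Arthur] \bysame, \emph{The endoscopic classification of representations: Orthogonal and symplectic groups}, American Mathematical Society Colloquium Publications, vol.~61, American Mathematical Society, Providence, RI, 2013, Orthogonal and symplectic groups. \MR{3135650}" / p0039:L51 "[GT] Toby Gee and Olivier Ta{\"i}bi, \emph{Arthur's multiplicity formula for $\mathrm{GSp}_4$ and restriction to $\mathrm{Sp}_4$}, preprint, 2018." / p0040:L23 "[Mok] Chung~Pang Mok, \emph{Galois representations attached to automorphic forms on {${\rm GL}_2$} over {CM} fields}, Compos. Math. \textbf{150} (2014), no.~4, 523--567. \MR{3200667}"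

/-- C29 ⇐ MOK ∧ KMSW's node `StabOrdI` ∧ E43 ∧ C177 (`paper:doi-10-1215-00127094-3714971`).  THE STATUS SENTENCE: p0003:L39-41 "We note that as in our earlier paper [CT15], our proofs rely on the work of Mok [Mok15], extending Arthur’s results to unitary groups; and that in turn Mok’s results are conditional on the stabilisation of the twisted trace formula. This has now been announced in preprint form by Mœglin and Waldspurger [MW]." — [Mok15] = the memoir, all ranks (U(9), U(7), their endoscopic groups U(4) × U(5), U(4) × U(3), and GL base change) ↦ `∀ N, μ.Everything N`.  WHERE MOK ENTERS: §2.2 p0008:L30-31 "to the work of Moeglin [Mœg07] and Mok [Mok15] there is a decomposition of Πtemp (Un ) as a disjoint union of sets Πϕ , as ϕ ranges over conjugacy classes of Langlands parameters" […] p0008:L36-39 "which are conjugate orthogonal; see [Mok15, Lemma 2.2.1]. In particular, there is a map Πtemp (Un ) → Πtemp (GLn,E ), with image given by those representations corresponding to conjugate orthogonal parameters. We say that such a representation π of GLn,E is in the image of the stable base change map. The fibres of the map Πtemp (Un ) → Πtemp (GLn,E ) are the L-packets Πϕ ." — [Mœg07] = C. Mœglin, Pacific J. Math. 233 (2007) =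 row E43 ↦ `Consumers45.MoeglinUnitaryDS`; §3 p0009:L87-88 "In §3 we will describe, following [Mok15], the endoscopic classification of representations of the group Un , and describe in more detail the L-packets of representations corresponding under this classification to" […]; p0018:L62-63 "If we replace G by its quasi-split form G∗ , we are reduced to the construction by Mok of endoscopic L-packets (Theorem 3.5). At the local primes of F ramified in the (CM) extension E defining G, we obtain," […] p0018:L68-69 "We are then ready to transfer Mok’s representations to the R-anistropic group G. This is done in §3.6, using the methods in [CHL11]. The results are stated in Theorem 3.8, Theorem 3.10. It is again crucial" […]; THEOREM 3.2: p0020:L76-80 "Theorem 3.2 (Mœglin, Mok). The parameter ϕE determines an L–packet Πϕ of tempered representations of G. (i) If m = 3, Πϕ has two elements X, Y . (ii) If m ≥ 5, Πϕ has four elements X, Y , Z, W which belong to the discrete series of G. This follows from Arthur’s formalism; we refer to [Mok15, Theorem 2.5.1]. Let ϕ : LF → L G be the" […]; THE GLOBAL FORMULA: p0022:L90-91 "We can consider the datum (Πm , Π4 ⊗ µ) as an Arthur datum ψ in the sense of [Art], [Mok15], for the unitary group G. It defines a global group Sψ [Mok15, Definition 2.4.8], isomorphic to {±1} seen as" […]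 p0022:L97-98 "Theorem 3.5 (Mok). Assume given, for each v, a representation πv ∈ Πϕv , with πv almost everywhere" […] p0022:L100-103 "unramified. Then the representation π = ⊗v πv occurs in L2cusp (G(F )\G(A)) if and only if v hs, πv i = 1. In this case, it occurs with multiplicity one. This is essentially [Mok15, Theorem 2.5.2], taking into account the fact that the sign εψ is 1 since the parameter ψ is tempered. We have added the fact that π is cuspidal in our case: this follows from Mok’s" […]; p0027:L38 "Proposition 3.7 (Mœglin). The Jacquet module of πH contains, with multiplicity 2, the character" […] (Mœglin's proposition, proved for this paper: absorbed); THE DEFINITE GROUP: p0029:L44-46 "The proof of Theorem 3.8 will rely on Theorem 3.5. Consider first the quasi–split group G∗ . By Arthur’s stabilization of the trace formula [Art03] (we use Arthur’s formulation in [Art05]) we have, for a" […] p0031:L4-5 "imply that these sums are equal, and this implies that strong, stable base change for G follows from the analogous result for G∗ proved by Mok: see [Mok15, Theorem 2.5.2]." p0031:L44-47 "Note that the fv for finite primes, outside the set specifying ψ, are arbitrary. Mok’s results, specifically [Mok15, Theorem 2.5.2] now applied to base change to G(E) rather than descent, imply the existence of a stable base change π of σ - a RACSD representation of G(AE ) -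 with local components in the correct Lpackets at all finite primes; at infinite primes π is cohomological and its infinitesimal character is associated to the trivial representation of G(F∞ ). Thus π is, at all primes, the stable base change of σ." — the stabilisation of the (ordinary) trace formula for the ℝ-anisotropic unitary group G and the comparison of [CHL11] (Clozel – Harris – Labesse), with [Art03] / [Art05] and [Lab11]: in the register this is KMSW's node `StabOrdI` (an inner form of U(n); typed so for part II = row C177, tranche 18, whose frame this paper continues) ↦ `κ.StabOrdI`; §4: p0033:L10-11 "conclude that the isotropic subspace S(U0 , k) (localized at m and e, or rather e = e mod l), is too large, by using Mok’s multiplicity formula. We refer the reader to the end of §4 for the precise argument."; §6: p0044:L52-57 "Theorem 6.1. Let F be a totally real field, and let (π, χ) be a RAESDC automorphic representation of GL2 (AF ) which is not automorphically induced from a quadratic CM extension. Then: 1. Suppose that F ∩Q(ζ5 ) = Q. Then the 6th symmetric power lifting of π exists, as a cuspidal automorphic representation of GL7 (AF ). 2. Suppose that F ∩Q(ζ7 ) = Q. Then the 8th symmetric power lifting of π exists, as a cuspidal automorphic representation of GL9 (AF )." p0044:L58 "By a series of reductions which are essentially the same as those of [CT15, §6], it is enough to prove" […] — [CT15] = part II,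 Ann. of Math. 181 (2015) = row C177 ↦ `Consumers18.ClozelThorne2` (its reductions and Proposition 3.10 are used).  [Art] (the book) is cited for the FORMALISM of Arthur data (p0022:L90-91 "We can consider the datum (Πm , Π4 ⊗ µ) as an Arthur datum ψ in the sense of [Art], [Mok15], for the unitary group G. It defines a global group Sψ [Mok15, Definition 2.4.8], isomorphic to {±1} seen as" […] p0022:L97-98 "Theorem 3.5 (Mok). Assume given, for each v, a representation πv ∈ Πϕv , with πv almost everywhere" […] p0022:L100-103 "unramified. Then the representation π = ⊗v πv occurs in L2cusp (G(F )\G(A)) if and only if v hs, πv i = 1. In this case, it occurs with multiplicity one. This is essentially [Mok15, Theorem 2.5.2], taking into account the fact that the sign εψ is 1 since the parameter ψ is tempered. We have added the fact that π is cuspidal in our case: this follows from Mok’s" […]), not for a theorem on orthogonal / symplectic groups: no book premise (as for C177).  Arthur-free, absorbed: [Tho15] (automorphy lifting), [BLGG11], [CHT08], [HSBT10], [Ree00] (Reeder's Hecke modules), [Lab11], [CHL11], [Clo93], Ramakrishnan, Kim – Shahidi, [KS02].  Premises: Mok (all ranks), `StabOrdI`, `MoeglinUnitaryDS`, `ClozelThorne2`.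 [cite: ClozelThorne2017III, §1 (p0003:L39-41), §2.2 (p0008:L30-39), §3 (p0009:L87-88, p0018:L62-69, p0020:L76-80, p0022:L90-103, p0027:L38, p0029:L44-46, p0031:L4-5, L44-47), §4 (p0033:L10-11), §6 (p0044:L58); ClozelThorne2015, as [CT15]; Moeglin2007Unitary, as [Mœg07]; Mok2012, as [Mok15]] -/
def E_ClozelThorneIII : Prop :=
  (∀ N, μ.Everything N) → κ.StabOrdI → c₄₅.MoeglinUnitaryDS → c₁₈.ClozelThorne2 → c₆₄.ClozelThorneIII

/-- C171 ⇐ THE BOOK (`paper:arxiv-1308.2192`).  p0006:L6-7 "As we utilise Arthur's classification for representations of classical groups, our result depends on a few hypotheses which his work depends on. (See Remark (r:hypotheses) below.) The reader may skip to"; §3.3: p0007:L19 "3.3 Arthur's endoscopic classification for $\SO_{2m+1}$" p0007:L21-23 "Arthur [Arthur] classified local and global automorphic representations of symplectic and special orthogonal groups via twisted endoscopy relative to general linear groups. For our purpose it suffices to recall some facts in the case of odd orthogonal groups." […] p0007:L38-41 "For each local $L$-parameter $\phi_v:\cL_{F_v}\ra \Sp_{2m}(\C)$ (or a local $L$-parameter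 for $\GL_{2m}$ of symplectic type), Arthur associates an $L$-packet $\Pi_{\phi_v}$ consisting of finitely many irreducible representations of $\SO_{2m+1}(F_v)$. Moreover each irreducible representation belongs to the $L$-packet for a unique parameter (up to equivalence). If $\phi_v$ has finite centraliser group in $\Sp_{2m}(\C)$ so that it is a discrete parameter, then $\Pi_{\phi_v}$ consists only of discrete series. A similar construction" […] p0007:L44-47 "Now let $\tau$ be a discrete automorphic representation of $\SO_{2m+1}(\A_F)$. Arthur shows the existence of a self-dual isobaric automorphic representation $\pi$ of $\GL_{2m}(\A_F)$ which is a functorial lift of $\tau$ along the embedding $\Sp_{2m}(\C)\hra \GL_{2m}(\C)$. In the generic case (in Arthur's sense, i.e. when the $\SL_2$-factor in the global $A$-parameter for $\tau$ has trivial image), this means that for the unique $\phi_v$ such that $\tau_v\in \Pi_{\phi_v}$, we have" […]; THE AUTHORS' STATUS REMARK 3.3 (2013/2015), complete for its date: p0007:L51-57 "Remark 3.3. Arthur's result [Arthur] is conditional on the stabilisation of the twisted trace formula and a few expected technical results in harmonic analysis as explained there. See [BMM] for a summary of these issues. We also note that the references [A24]-[A28] in Arthur's book are in preparation at the time our paper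 is finished. Since these results are expected to become available from ongoing projects by others or by Arthur himself, the authors think that one need not strive hard to avoid using them. However see Remark (r:alternative) below for a possible alternative approach."; §3.4: p0008:L22 "Arthur associates a local $L$-packet $\Pi_{\phi^M_t}$ of irreducible $M(\Q_t)$-representations to $\phi^M_t$." […] p0008:L25-26 "effect of the parabolic induction on $L$-parameters is simply composition with $\eta^M$ (this is implicit in the proof of the proposition 2.4.3 in [Arthur]), the $L$-parameter for any $\tau_t\in \hat{U}_t$ has the following form (after composing with $\xi$):" […]; Theorem 3.4's closing sentence and proof (p0008:L40-41 "Theorem 3.4. There exists a cuspidal automorphic representation $\pi$ of $\GL_{n}(\A_\Q)$ such that" p0008:L43 "* $\pi$ is unramified away from $q$ and $t$," p0008:L45 "* $ \rec_q(\pi_q)\simeq \WD(\rho_q)$," […] p0008:L53 "* the central character of $\pi$ is trivial." p0008:L55 "As we rely on Arthur's work [Arthur], our theorem is conditional as explained in Remark (r:hypotheses)." PROOF: p0008:L69-69 "Then the functorial lift $\pi$ of $\tau$ as in (sub:Arthur) has the desired properties ((item:i))–((item:v))" […]) — [Arthur] = the book (cited as the Clay preprint): the local packets Π_φ_v of SO_{n+1}(ℚ_v)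 (with Proposition 2.4.3) and the transfer τ ↦ π to GL_n, for the one rank m = n/2 the theorem needs and all smaller ones in the induction-free argument — typed at all ranks ↦ `∀ N, ν.Everything N` (the register's only granularity; declared); Remark 3.5 (p0009:L1-3 "Remark 3.5. A slightly different version for the existence of $\tau$ can be shown by using Theorem 5.13 of [S], which is obtained via the simple trace formula for $G$, instead of using Proposition (p:existence2). Then one can prescribe $\tau_\infty$ to be any favourite discrete series" […] p0009:L4-6 "at the expense of losing control of ramification at two auxiliary primes. On the other hand, it is conceivable that one can prove the existence of $\pi$ directly, without going through representations of $G$ (thus avoiding the use of twisted endoscopy), via the simple twisted trace formula for $\GL_n$ due to Deligne-Kazhdan as long as one is willing to allow ramification at one auxiliary" […]) indicates an Arthur-free alternative via the simple twisted trace formula, NOT carried out: recorded, the typed edge follows the printed proof.  [BMM] = Bergeron – Millson – Mœglin (cited for a summary of the issues: context), [S] / [Shin] (Shin's existence theorems, the simple trace formula), Khare – Larsen – Savin [KLS1], parts I – II of the series, Deligne – Kazhdan, Rogawski – Mezo [CC09], Arthur – Clozel base change: published, Arthur-free, absorbed.  Premises: the book (all ranks). [cite: AriasDeReynaDieulefaitShinWiese2015,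 §3 (p0006:L6-7), §3.3 (p0007:L19-57), §3.4 (p0008:L22-26, L40-69), Rem. 3.5 (p0009:L1-6); Arthur2013, as [Arthur]] -/
def E_ADSWInverseGalois : Prop := (∀ N, ν.Everything N) → c₆₄.ADSWInverseGalois

/-- C57 ⇐ THE BOOK ∧ C10 (`paper:arxiv-1910.03164`).  THE INPUTS NAMED: p0003:L7 "These two marvelous developments allow (e.g., [ks]) the construction of $\SO{2n+1}$-valued Galois representations associated to cuspidal automorphic representations of $G=\Sp{2n}$ that are discrete series at infinity and Steinberg at some finite prime (and indeed more generally)." […] p0003:L11 "We now return to the setup of our paper. The deepest inputs for our potential automorphy theorems are the potential automorphy theorem of Barnet-Lamb, Gee, Geraghty, Taylor of [blggt] (and, for the strongest statement, a recent improvement due to Calegari, Emerton, and Gee in [calegari-emerton-gee]) and Arthur's work ( [art13]). We develop these and their relationships with the construction of [ks] to prove the following two potential automorphy results, one for mod $p$ and one for $p$-adic representations. Here and throughout the paper, we let $\op{std} \colon \mr{GSpin}_{2n+1} \to \mr{GL}_{2n+1}$ denote the standard representation, and we let $N \colon \mr{GSpin}_{2n+1} \to \mb{G}_m$ denote the Clifford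 norm." — [ks] = A. Kret – S. W. Shin, *Galois representations for general symplectic groups* = row C10 ↦ `Consumers.KretShinGSp` (tranche 1: ⇐ book ∧ A7); p0004:L40-41 "The strategy here is to combine the potential automorphy theorem of [calegari-emerton-gee] with [art13] to realize the projection $P(r) \colon \Gamma_{F^+} \to \mr{SO}_{2n+1}(\bZp)$, after restriction to some $L^+$, as the representation $r_{\pi, \iota}$ associated to a cuspidal automorphic representation of $\pi$ of $\mr{Sp}_{2n}(\mb{A}_{L^+})$. Then we show that $\pi$ can be extended to a cuspidal automorphic representation $\tilde{\pi}$ of $\mr{GSp}_{2n}(\mb{A}_{L^+})$ that satisfies the hypotheses of the main theorem of [ks], and finally we check that a suitable twist of $\tilde{\pi}$ in fact corresponds to our original $r|_{\Gamma_{L^+}}$."; PROPOSITION 4.5 AND ITS PROOF: p0013:L16 "In the next result we use Arthur's endoscopic classification, which for our purposes proves the local Langlands correspondence for $\mr{Sp}_{2n}(L^+_w)$ (for all places $w$; of course, for infinite places this is due to Langlands) and describes the discrete automorphic spectrum of $\mr{Sp}_{2n}(\mb{A}_{L^+})$ in terms of self-dual isobaric automorphic representations of $\mr{GL}_{2n+1}(\mb{A}_{L^+})$.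 We will try to phrase the following argument in a way that will help the uninitiated reader to parse the main results of [art13]. In what follows, for an admissible smooth representation (or admissible $(\mf{g}, K)$-module) $\tau$ of either $\mr{GL}_{2n+1}(L^+_v)$ or $\mr{Sp}_{2n}(L^+_v)$, we will write $\phi_{\tau}$ for the local Langlands parameter associated to $\tau$ in, respectively, [ht] or [art13]." p0013:L18-19 "Proposition 4.5. There is a cuspidal automorphic representation $\pi$ of $\sp{2n}{\mb A_{L^+}}$ with the following properties:" […] PROOF: p0013:L36-37 "Since $\Pi$ is self-dual cuspidal automorphic, it corresponds to a simple generic parameter in the sense of [art13]. By [art13] there is a unique elliptic (and in fact simple) endsocopic group $G$ with a discrete automorphic representation $\pi$ of $G$ whose system of unramified Hecke eigenvalues gives rise to those of $\Pi$; and since $2n+1$ is odd, $G$ is necessarily the split group $\mr{Sp}_{2n}/L^+$. Simply by definition, $\Pi$ thus gives rise to a parameter $\psi \in \widetilde{\Psi}(G)$, in the sense of [art13]. By [art13], the local Langlands parameters $\phi_{\Pi_v}$ factor through $\mr{SO}_{2n+1} \subset \mr{GL}_{2n+1}$, and then the central results [art13] establish the local Langlands correspondence for $G$ and show that the descent $\pi$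 of $\Pi$ (the multiplicity here is one, in fact) is everywhere locally compatible with this local Langlands correspondence, which yields part (1) of our Proposition." […]; §6: p0020:L9 "Now, by [art13], there is a cuspidal automorphic representation $\pi_{K^+}$ of $\mr{Sp}_{2n}(\mathbb{A}_{K^+})$ transferring to $\Pi_{K^+}$, and more precisely satisfying the conclusions of Proposition (descent). We can then apply Proposition (lift aut) to lift $\pi_{K^+}$ to a cuspidal automorphic representation of $\tilde{\pi}_{K^+}$ satisfying the conclusions of loc. cit., and in particular having an associated Galois representation $r_{\tilde{\pi}_{K^+}, \iota_{\ell}} \colon \Gamma_{K^+} \to \mr{GSpin}_{2n+1}(\bQl)$. Finally, we compare $r|_{\Gamma_{K^+}}$ with $r_{\tilde{\pi}_{K^+}, \iota_{\ell}}$. Their compositions with $P \colon \mr{GSpin}_{2n+1} \to \mr{SO}_{2n+1}$ are $\mr{SO}_{2n+1}$-conjugate upon restriction to $\Gamma_{L^+}$ (taking note of the uniqueness statement in [ks]), so we may assume they have equal restriction to $\Gamma_{L^+}$. We claim that $P(r|_{\Gamma_{K^+}})$ and $P(r_{\tilde{\pi}_{K^+}, \iota_{\ell}})$ are necessarily equal.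 Indeed, any two homomorphisms $r_1, r_2 \colon \Gamma_{K^+} \to \mr{SO}_{2n+1}(\bQl)$ that are $\mr{GL}_{2n+1}$-irreducible and become equal after restriction to $\Gamma_{L^+}$ must be equal: $r_1=r_2 \cdot \eta$ for some character $\eta$ of $\mr{Gal}(L^+/K^+)$, by the irreducibility, and then $\eta$ necessarily satisfies $\eta^{2n+1}=1$ and $\eta^2=1$, hence $\eta=1$." — [art13] = the book: the descent of a self-dual cuspidal Π of GL_{2n+1}(𝔸_{L^+}) to a cuspidal π of Sp_{2n} with prescribed local parameters (simple generic parameters, Theorem 1.5.2) and the LLC for Sp_{2n}(L^+_w), every n ↦ `∀ N, ν.Everything N`.  [blggt], [calegari-emerton-gee], [clozel], [ht], [taylor-yoshida], [ms], Taylor's potential automorphy method: published, Arthur-free, absorbed.  No status sentence (census G-i, CONFIRMED: grep conditional / twisted trace / unpublished → 0).  Premises: the book (all ranks), `KretShinGSp`. [cite: PatrikisTang2022GSpin, §1 (p0003:L7, L11, p0004:L40-41), §4 (p0013:L16-37), §6 (p0020:L9); KretShin2022, as [ks]; Arthur2013, as [art13]] -/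
def E_PatrikisTangGSpin : Prop := (∀ N, ν.Everything N) → c.KretShinGSp → c₆₄.PatrikisTangGSpin

/-- C34 ⇐ THE BOOK ∧ A4 ∧ C191 (`paper:arxiv-1907.08691`).  THE STATUS PARAGRAPH: p0005:L1-6 "In Section (sec:balanced-property), we make use of the results of [arthur-gsp4], which sketches how the results of [Arthur] on orthogonal and symplectic groups can be extended to the general symplectic group $\GSp_4$. At the time of the initial submission of this paper, these results of Arthur are conditional on the stabilization of the twisted trace formula. (We direct the reader to [GT] for the most up to date status of these results for $\GSp_4$.)" — [arthur-gsp4] = J. Arthur, *Automorphic representations of GSp(4)* (2004, the announcement) and [Arthur] = the book: routed as in tranches 19 – 29 (rows C83 – C85, C49) to the book at all ranks ↦ `∀ N, ν.Everything N` AND to [GT] = T. Gee – O. Taïbi, J. Éc. polytech. Math. 6 (2019) = row A4 ↦ `Consumers.GeeTaibi` (the proof of the GSp₄ classification the authors defer to); WHERE IT IS USED (§(balanced-property) and §4): p0021:L86-88 "For the last part: let $\pi$ the transfer to $\GL_4$ (given by [arthur-gsp4]) of the automorphic representation generated by $f$. Then $\pi$ descends to an automorphic representation $\Pi$ of a" […]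 p0027:L109-110 "inclusion (for some embedding $K \into \C$). Let $\widetilde{\pi}$ denote the transfer of $\pi$ to $\GL_4(\A)$ under the Classification Theorem of [arthur-gsp4]." p0028:L1-3 "The representation $\widetilde{\pi}$ falls into one of 6 classes (a)–(f) given in Section 5 of [arthur-gsp4]." […] p0028:L70-77 "The first point follows from [harris-ann-arb] which says that both spaces are one dimensional. The second point follows from [arthur-gsp4]. Indeed, since $\pi(\lambda, C_i)$ is essentially tempered, the local packet $\Pi_{\psi_{\infty}}$ (where $\psi = \widetilde{\pi} \boxplus 1$, in the notation of [arthur-gsp4]) is in fact an L-packet by [Mok]. Furthermore, it consists of the pair of representations $\{ \pi(\lambda, C_0), \pi(\lambda, C_1) \}$ (see [Mok])." […] p0028:L79-80 "trivial in Case (a) of [arthur-gsp4], it then follows from part (ii) of the Classification Theorem that $\pi'$ is also" […] — [Mok] = C. P. Mok, Compositio Math. 150 (2014) = row C191 ↦ `Consumers28.MokGSp4` (the archimedean packet {π(λ, C_0), π(λ, C_1)} and local-global compatibility; tranche 28: ⇐ book ∧ A4).  [harris-ann-arb], [CG] (the authors' Invent. Math. method), Taylor, Tilouine, Pilloni's higher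 Hida theory, Lan – Suh, Wallach: published, Arthur-free, absorbed.  Premises: the book (all ranks), `GeeTaibi`, `MokGSp4`. [cite: CalegariGeraghty2020Nonregular, §1.4 (p0005:L1-6), §4 (p0021:L86-88), §(balanced-property) (p0027:L109-110, p0028:L1-3, L70-80); GeeTaibi2019, as [GT]; Mok2014Compositio, as [Mok]; Arthur2013, as [Arthur] / [arthur-gsp4]] -/
def E_CalegariGeraghtyGSp4 : Prop := (∀ N, ν.Everything N) → c.GeeTaibi → c₂₈.MokGSp4 → c₆₄.CalegariGeraghtyGSp4

/-- The sixty-fourth tranche of implications: C29's edge, C171's, C57's, C34's. [cite: ClozelThorne2017III, Thm 6.1; AriasDeReynaDieulefaitShinWiese2015, Thm 3.4; PatrikisTang2022GSpin, Thm 1.1; CalegariGeraghty2020Nonregular, Thm 1.1 (each edge's source in its own docstring)] -/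
structure Implications64 : Prop where
  ct3 : E_ClozelThorneIII μ κ c₁₈ c₄₅ c₆₄
  adsw : E_ADSWInverseGalois ν c₆₄
  pt : E_PatrikisTangGSpin ν c c₆₄
  cg : E_CalegariGeraghtyGSp4 ν c c₂₈ c₆₄

variable {ν μ κ c c₁₃ c₁₄ c₁₈ c₁₉ c₂₈ c₄₃ c₄₄ c₄₅ c₆₄}

/-- THE WHOLE TRANCHE GIVEN THE CLASSIFICATIONS' OUTPUTS, KMSW's NODE AND THE TYPED ROWS. [cite: ClozelThorne2017III, Thm 6.1; AriasDeReynaDieulefaitShinWiese2015, Thm 3.4; PatrikisTang2022GSpin, Thm 1.1; CalegariGeraghty2020Nonregular, Thm 1.1 (bookkeeping proved here)] -/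
theorem galoisII_of_rows (Z : Implications64 ν μ κ c c₁₈ c₂₈ c₄₅ c₆₄) (hν : ∀ N, ν.Everything N) (hμ : ∀ N, μ.Everything N)
    (hS : κ.StabOrdI) (h₄₃ : c₄₅.MoeglinUnitaryDS) (h₁₇₇ : c₁₈.ClozelThorne2) (hA4 : c.GeeTaibi) (h₁₉₁ : c₂₈.MokGSp4)
    (h₁₀ : c.KretShinGSp) :
    c₆₄.ClozelThorneIII ∧ c₆₄.ADSWInverseGalois ∧ c₆₄.PatrikisTangGSpin ∧ c₆₄.CalegariGeraghtyGSp4 :=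
  ⟨Z.ct3 hμ hS h₄₃ h₁₇₇, Z.adsw hν, Z.pt hν h₁₀, Z.cg hν hA4 h₁₉₁⟩

/-- C29 FROM MOK'S AND KMSW'S INPUTS AND THE BOOK'S PUBLISHED LEAVES: with tranche 18's edge (C177 ⇐ Mok ∧ `StabOrdI`) and tranche 45's
(E43 ⇐ five PUBLISHED leaves of the book's DAG), the symmetric-power theorem follows from `MokInputs`, `KMSWInputs` (its node `StabOrdI`
through KMSW's supply edge) and `ν.PublishedLeaves` — no open leaf of the book. [cite: ClozelThorne2017III, Thm 6.1 with p0003:L39-41, p0029:L44-46 (bookkeeping proved here)] -/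
theorem clozelThorneIII_of_inputs (Z : Implications64 ν μ κ c c₁₈ c₂₈ c₄₅ c₆₄) (Y₁₈ : Implications18 ν μ κ c₁₈)
    (V : Implications45 ν μ κ c₁₃ c₁₄ c₄₃ c₄₄ c₄₅) (P : ν.PublishedLeaves) (M : MokInputs μ) (K : KMSWInputs μ κ) :
    c₆₄.ClozelThorneIII :=
  Z.ct3 M.everything (KMSWInputs.stabOrdI K) (moeglinUnitaryDS_of_published V P) (clozelThorne2_of_leaves Y₁₈ M K)

/-- C29 IN CONDITIONAL FORM, 2026 (the paper's own sentence names the twisted stabilisation only, G-ii): granting Mok's section edges and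
supplies, every PUBLISHED input of the memoir, KMSW's supply edge for the definite group's stabilisation with its published inputs, E43's
published leaves and the typed rows' edges, Theorem 6.1 is conditional on Mok's 2024–2026 PREPRINT layer and on the weighted fundamental
lemmas: Mok's general and non-standard ones and, on the definite group's side, KMSW's general one — exactly part II's residue
(`ct2_conditional_form`). [cite: ClozelThorne2017III, p0003:L39-41; ClozelThorne2015, §1.1 (bookkeeping proved here)] -/
theorem clozelThorneIII_conditional_form (Z : Implications64 ν μ κ c c₁₈ c₂₈ c₄₅ c₆₄) (Y₁₈ : Implications18 ν μ κ c₁₈)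
    (V : Implications45 ν μ κ c₁₃ c₁₄ c₄₃ c₄₄ c₄₅) (P : ν.PublishedLeaves) (MB : μ.SectionEdges) (MS : μ.SupplyEdges)
    (MP : μ.PublishedLeaves) (KS : κ.SupplyEdges) (KP : κ.PublishedLeaves) :
    μ.PreprintLeaves2026 → μ.WFL_general → μ.WFL_nonstandard → κ.WFL_general → c₆₄.ClozelThorneIII :=
  fun hQ h6 h7 k6 =>
    have m : ∀ N, μ.Everything N := MokInputs.everything ⟨MB, MS, MP, hQ, ⟨h6, h7⟩⟩
    Z.ct3 m (KS.stabOrd KP.fl KP.wfl_split k6 KP.stf KP.transfer) (moeglinUnitaryDS_of_published V P)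
      (Y₁₈.ct2 m (KS.stabOrd KP.fl KP.wfl_split k6 KP.stf KP.transfer))

/-- THE THREE BOOK ROWS (C171, C57, C34) FROM THE BOOK'S INPUTS: with tranche 1's edges (A4, C10 ⇐ book and its similitude / Xu nodes as typed
there) and tranche 28's (C191 ⇐ book ∧ A4), the three theorems follow from `BookInputs` alone. [cite: AriasDeReynaDieulefaitShinWiese2015, Thm 3.4; PatrikisTang2022GSpin, Thm 1.1; CalegariGeraghty2020Nonregular, Thm 1.1 (bookkeeping proved here)] -/
theorem galoisII_bookRows_of_inputs (Z : Implications64 ν μ κ c c₁₈ c₂₈ c₄₅ c₆₄) (I : Implications ν μ κ c)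
    (X : Implications28 ν μ κ c c₁₉ c₂₈) (A : BookInputs ν) :
    c₆₄.ADSWInverseGalois ∧ c₆₄.PatrikisTangGSpin ∧ c₆₄.CalegariGeraghtyGSp4 :=
  have b := A.everything
  ⟨Z.adsw b, Z.pt b (kretShin_of_leaves I A), Z.cg b (geeTaibi_of_leaves I A) (mokGSp4_of_leaves X I A)⟩

/-- C171, C57, C34 IN CONDITIONAL FORM, 2026: granting the book's edges, supply edges and every PUBLISHED input (the twisted stabilisation
that C171's and C34's sentences named among them) and the typed rows' edges, the three theorems follow from the book's seven 2024–2026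
PREPRINT leaves (C171's « [A24]-[A28] … in preparation », as supplied since) and its two UNWRITTEN weighted fundamental lemmas (C171's « a
few expected technical results in harmonic analysis »).  C57 prints no status sentence. [cite: AriasDeReynaDieulefaitShinWiese2015, Rem. 3.3 (p0007:L51-57); CalegariGeraghty2020Nonregular, p0005:L4-6; PatrikisTang2022GSpin, p0003:L11 (bookkeeping proved here)] -/
theorem galoisII_bookRows_conditional_form (Z : Implications64 ν μ κ c c₁₈ c₂₈ c₄₅ c₆₄) (I : Implications ν μ κ c)
    (X : Implications28 ν μ κ c c₁₉ c₂₈) (B : ν.BookEdges) (S : ν.SupplyEdges) (P : ν.PublishedLeaves) :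
    ν.PreprintLeaves2026 → ν.UnwrittenLeaves → c₆₄.ADSWInverseGalois ∧ c₆₄.PatrikisTangGSpin ∧ c₆₄.CalegariGeraghtyGSp4 :=
  fun Q U => galoisII_bookRows_of_inputs Z I X ⟨B, S, P, Q, U⟩

/-- THE WHOLE TRANCHE FROM THE LEAVES OF THE THREE DAGS. [cite: ClozelThorne2017III, Thm 6.1; AriasDeReynaDieulefaitShinWiese2015, Thm 3.4; PatrikisTang2022GSpin, Thm 1.1; CalegariGeraghty2020Nonregular, Thm 1.1 (bookkeeping proved here)] -/
theorem galoisII_of_leaves (Z : Implications64 ν μ κ c c₁₈ c₂₈ c₄₅ c₆₄) (Y₁₈ : Implications18 ν μ κ c₁₈)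
    (V : Implications45 ν μ κ c₁₃ c₁₄ c₄₃ c₄₄ c₄₅) (I : Implications ν μ κ c) (X : Implications28 ν μ κ c c₁₉ c₂₈) (A : BookInputs ν)
    (M : MokInputs μ) (K : KMSWInputs μ κ) :
    c₆₄.ClozelThorneIII ∧ c₆₄.ADSWInverseGalois ∧ c₆₄.PatrikisTangGSpin ∧ c₆₄.CalegariGeraghtyGSp4 :=
  ⟨clozelThorneIII_of_inputs Z Y₁₈ V A.published M K, galoisII_bookRows_of_inputs Z I X A⟩

/-! ## Sixty-fifth tranche (v2, unit `pub-arthur-down-g30`): THE GALOIS SIDE, III — C176 `PatrikisTate`, C51 `MagaardSavinG2`, C45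
`CaraianiTamiozzoTorsion`, C38 `PilloniStrohGalois` — and C56 `JLXReciprocal`

Context (`DOWNSTREAM.md` rows C176 l.746 `[g13d]`, C51 l.205, C45 l.199, C38 l.192, C56 l.210 `[g2]` — never typed; typed premises reused:
`Consumers.ScholzeTR` (row C12, tranche 1 ⇐ book ∧ Mok), `Consumers8.InnerTwists` (the Chapter-9 node, tranche 8) and `Consumers8.JZmain` (row C16,
tranche 8 ⇐ book ∧ Mok ∧ KMSW's scope ∧ `InnerTwists`); block `[g30e]` of `DOWNSTREAM3.md`.  Texts staged under `HOME/pub-arthur-down-g30/primaries/`: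
`paper:arxiv-1207.6724` (C176, TeX 92 chunks), `paper:arxiv-1406.3773` (C51, TeX 12 chunks), `paper:arxiv-2107.10081` (C45, TeX 38 chunks),
`paper:doi-10-1007-s40316-015-0056-0` (C38, HAL PDF text 33 pp.), `paper:arxiv-1812.03162` (C56, TeX 23 chunks).  Loci: C176 p0002:L3, p0040:L15-36,
p0041:L30, p0090:L25-27, p0091:L125-127; C51 p0002:L3-9, p0010:L72-100, p0011:L1-4, p0012:L5; C45 p0003:L55-58, L75-80, p0008:L24-41, p0009:L5, p0037:L9,
p0038:L33; C38 p0002:L33-34, p0003:L3-7, p0018:L8-15, L39-46, p0019:L3-5, L40-47, p0031:L15-18, L66, p0032:L17-20; C56 p0002:L7-8, p0003:L24-29,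
p0005:L6-9, L27, L36-48, p0006:L3-7, p0021:L52, L57-59, L64-66, p0023:L12-14, L74-75. -/

/-- Rows C176, C51, C45, C38, C56 of the census, as an arbitrary assignment of propositions; nothing about the content of a field is assumed. [cite: Arthur2013, downstream register of the cell, sixty-fifth tranche (structure only)] -/
structure Consumers65 where
  /-- C176 (census: found by the 2016–2026 cross-check; no status sentence): Stefan Patrikis, *Variations on a theorem of Tate*, Mem. Amer. Math. Soc. 258 (2019) no. 1238, doi:10.1090/memo/1238 = arXiv:1207.6724 (corpus TeX `paper:arxiv-1207.6724`, 92 chunks) — ABSTRACT: p0002:L3 "Let $F$ be a number field. These notes explore Galois-theoretic, automorphic, and motivic analogues and refinements of Tate's basic result that continuous projective representations $\mathrm{Gal}(\overline{F}/F) \to \mathrm{PGL}_n(\mathbb{C})$ lift to $\mathrm{GL}_n(\mathbb{C})$. We take special interest in the interaction of this result with algebraicity (for automorphic representations) and geometricity (in the sense of Fontaine-Mazur). On the motivic side, we study refinements and generalizations of the classical Kuga-Satake construction. Some auxiliary results touch on: possible infinity-types of algebraic automorphic representations; comparison of the automorphic and Galois “Tannakian formalisms"; monodromy (independence-of-$\ell$)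 questions for abstract Galois representations." §8: p0040:L15-15 "If we make additional assumptions so that potential automorphy theorems apply, we can of course say more. The next couple lemmas merely cash in on some very deep recent results." p0040:L17-18 "Lemma 8.0.6. Assume that $\rho \colon \gal{F} \to \mr{SO}_{2n+1}(\Qlb) \subset \mr{GL}_{2n+1}(\Qlb)$ as in the previous proposition moreover satisfies:" p0040:L20 "* For all $v \vert \ell$, $\rho|_{\gal{F_v}}$ is regular and potentially diagonalizable;" p0040:L22 "* $\bar{\rho}|_{\gal{F(\zeta_\ell)}}$ is irreducible." p0040:L24 "* $\ell \geq 2(2n+2)$." p0040:L26 "Then after some totally real base change $F'/F$, there exists a regular $L$-algebraic self-dual cuspidal automorphic representation $\pi$ on $\mr{GL}_{2n+1}/F'$ such that $\pi \longleftrightarrow \rho$." LEMMA 8.0.7: p0040:L30-31 "Lemma 8.0.7. Let $\rho \longleftrightarrow \pi$ be as in Lemma (cashin1). Then $\pi$ descends to a cuspidal automorphic representation on $\mr{Sp}_{2n}/F'$." PROPOSITION 8.0.8: p0040:L35-36 "Proposition 8.0.8. Continuing with the assumptions (and conclusions) of the previous two lemmas, $\rho|_{\gal{F'}}$ has a geometric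 lift to $\mr{GSpin}_{2n+1}(\Qlb)$ if and only if $\pi$ admits an $L$-algebraic extension to $\mr{GSp}_{2n}(\af)$. In the other direction, we have, as in Lemma (limmult), an automorphic construction of infinitely many such $\rho$, whose local behavior[i.e. inertial type] we can additionally specify at any finite number of places, that do not admit a geometric lift." [cite: Patrikis2019Variations, Lemma 8.0.6 (p0040:L17-26), Lemma 8.0.7 (p0040:L30-31), Prop. 8.0.8 (p0040:L35-36)] -/
  PatrikisTate : Prop
  /-- C51 (census grade G-i): Kay Magaard – Gordan Savin, *Computing finite Galois groups arising from automorphic forms*, J. Algebra 561 (2020) 256–272, doi:10.1016/j.jalgebra.2019.09.031 = arXiv:1406.3773 (corpus TeX `paper:arxiv-1406.3773`, 12 chunks) — p0002:L3-9 "Let $p$ be a prime and $G_2(p)$ the exceptional group of type $G_2$ over the finite field of $p$ elements. The goal of this paper is to construct $G_2(p)$ as a Galois group over $\mathbb Q$ by reducing, modulo $p$, the $p$-adic representation attached to a regular, self-dual, cuspidal automorphic representation of $GL_7$. The first step in this direction was taken in [GS] where an algebraic, in the sense of Gross [Gr], automorphic representation $\pi$ was constructed on an anisotropic form of $G_2$.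 It was also shown that $\pi$ lifts to a cuspidal automorphic representation $\Sigma$ on $Sp_6$. In Section 8 we show that $\Sigma$ lifts to a regular, self-dual cuspidal automorphic representation $\Pi$ on $GL_7$ by the recent results of Arthur [Ar]. Since the field of definition of $\Pi$ is $\mathbb Q$, using a result of Taylor [Ta], in Section 7 we prove that the $p$-adic representation of $\Gal(\bar{\mathbb Q}/\bbQ)$ attached to $\Pi$ is defined over $\mathbb Q_p$." […] PROPOSITION 8.2 AND THEOREM 8.3: p0010:L72 "We shall now use the results of Arthur [Ar] to lift $\sigma$ to a cuspidal form on $GL_7$. We need the following." p0010:L74-75 "Proposition 8.2. Let $\sigma$ be a cuspidal automorphic representation on $Sp_{2n}$ such that $\sigma_q$ is the Steinberg representation for a prime $q$. Let $\Pi$ be the automorphic representation of $GL_{2n+1}$, the lift of $\sigma$ as in Theorem 1.5.2 in [Ar]. Then $\Pi_q$ is the Steinberg representation and $\Pi$ is cuspidal." […] p0011:L2 "Applying Theorem (main2) and Proposition (P:tempered) yields the following result:" p0011:L4 "Theorem 8.3. There exists an extension of $\bbQ$ with $G_2(p)$ as the Galois group, unramified at $5$ and $p$ only, for a set of primes $p$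 of density at least $1/18$." [cite: MagaardSavin2020G2, Prop. 8.2 (p0010:L74-75), Thm 8.3 (p0011:L4), §1 (p0002:L3-9)] -/
  MagaardSavinG2 : Prop
  /-- C45 (census grade: adequate blanket flag): Ana Caraiani – Matteo Tamiozzo, *On the étale cohomology of Hilbert modular varieties with torsion coefficients*, Compos. Math. 159 (2023), doi:10.1112/s0010437x23007431 = arXiv:2107.10081 (corpus TeX `paper:arxiv-2107.10081`, 38 chunks; F totally real of degree g, G = Res GL_2) — p0003:L55-58 "Take a maximal ideal $\m \subset \T$ in the support of $H^i_{(c)}(Sh_K(G), \F_{\ell})$. It follows from Scholze's work, at least when $\ell>2$, cf. Theorem (constr-gal-repn), that there exists a unique continuous, semisimple Galois representation" […] THEOREM 4 (§2.2): p0008:L24 "2.2 Construction of Galois representations" p0008:L26 "The aim of this section is to prove the following result." p0008:L28-30 "Theorem 4. Let $\ell$ be an odd prime and $K\subset G(\A_f)$ a neat compact open subgroup. Let $\m \subset \mathbb{T}$ be a maximal ideal in the support of $H^i(Sh_K(G), \F_{\ell})$ or $H^i_{c}(Sh_K(G), \F_{\ell})$ for some $i \geq 0$. There is a unique continuous, semisimple,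 totally odd Galois representation" […] p0008:L36-38 "such that, for all but finitely many places $v$ of $F$, $\bar{\rho}_\m$ is unramified at $v$ and the characteristic polynomial of $\bar{\rho}_{\m}(\mathrm{Frob}_v)$ is equal to $X^2-T_vX+S_vN(v) \pmod {\m}$." — the input of THEOREM 1: p0003:L75-80 "Theorem 1. (see Theorem (mainpart2)) Let $\ell>2$ be a prime and let $\m \subset \T$ be a maximal ideal in the support of $H^i_{c}(Sh_K(G), \F_{\ell})$ or $H^i(Sh_K(G), \F_{\ell})$. Assume that the image of $\bar{\rho}_{\m}$ is not solvable. Then $H^i(Sh_K(G), \F_{\ell})_\m=H^i_c(Sh_K(G), \F_{\ell})_\m$ is non-zero only for $i=g$." [cite: CaraianiTamiozzo2023, Thm 4 = Thm 2.2.1 (p0008:L24-38), Thm 1 (p0003:L75-80)] -/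
  CaraianiTamiozzoTorsion : Prop
  /-- C38 (census grade G-ii): Vincent Pilloni – Benoît Stroh, *Cohomologie cohérente et représentations Galoisiennes*, Ann. Math. Québec 40 (2016) no. 1, 167–202, doi:10.1007/s40316-015-0056-0 (HAL hal-01409532; corpus PDF text `paper:doi-10-1007-s40316-015-0056-0`, 33 pp.) — THÉORÈME 0.1: p0002:L33-34 "Théorème 0.1. — L’action de T agissant sur un groupe de cohomologie Hi (XG (K)tor , ω κ ) ou Hi (XG (K)tor , ω κ (−D)) se factorise en une action continue de Tp−ad ." REMARQUE 0.2: p0003:L3-7 "Remarque 0.2. — Soit λ un système de valeurs propres pour l’action de T sur un groupe de cohomologie cohérente. Si on sait associer à toute forme holomorphe cuspidale propre de poids régulier un système de représentations galoisiennes, alors on peut associer à λ un système de représentations galoisiennes (voir la section 3.11) qui vérifiera la compatibilité local-global aux places non-ramifiées." COROLLAIRE 3.12 (« Cas Siegel-Hilbert », G = Sp_2g over a totally real F): p0018:L39-46 "Corollaire 3.12. — Soit π une représentation automorphe pour G de niveau premier à un ensemble fini S de places de F contenant les places ramifiées au-dessus de Q. On suppose que π apparaı̂t dans la cohomologie cohérente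 de la variété de Siegel-Hilbert de genre g pour F et de niveau convenable. Soit Θπ : TS → E le système de valeur propre associé, à valeur dans un corps de nombres E. Alors pour toute place λ de E au dessus d’une place ` de Q, il existe une représentation du groupe de Galois GF, S` de l’extension maximale de F non ramifiée hors de S ∪ {w | `} : ρπ, λ : GF, S` → GL2g+1 (Eλ )" […] COROLLAIRE 3.13 (« Cas unitaire quasi-déployé »): p0019:L40-47 "Corollaire 3.13. — Soit π une représentation automorphe pour G qui apparaı̂t dans la cohomologie cohérente de la variété de Shimura unitaire connexe associée à G et de niveau premier à un ensemble fini S + de places de F + . Soit S l’ensemble fini de places de F au dessus d’une place de S + . Soit Θπ : TS → E le système de valeurs propres de π qui est à valeur dans un corps de nombre E. Pour toute place λ de E au dessus d’un nombre premier ` de Q, il existe une représentation du groupe de Galois GF, S` de l’extension maximale de F non ramifiée hors de S ∪ {w | `} : ρπ,λ : GF, S` −→ GL2g (Eλ )" […] [cite: PilloniStroh2016, Thm 0.1 (p0002:L33-34), Rem. 0.2 (p0003:L3-7), Cor. 3.12 (p0018:L39-46), Cor. 3.13 (p0019:L40-47)] -/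
  PilloniStrohGalois : Prop
  /-- C56 (census grade: partial — hypothesis on σ explicit, no status sentence): Dihua Jiang – Baiying Liu – Bin Xu, *A reciprocal branching problem for automorphic representations and global Vogan packets*, J. reine angew. Math. 765 (2020) 249–277, doi:10.1515/crelle-2019-0016 = arXiv:1812.03162 (corpus TeX `paper:arxiv-1812.03162`, 23 chunks; F a number field, τ on GL_2n(𝔸) of orthogonal type, σ cuspidal on SO(V_0)(𝔸), dim V_0 = 3, in the global Vogan packet of φ_τ0) — p0002:L7-8 "In this paper, we investigate the reciprocal branching problem for automorphic representations of special orthogonal groups using the twisted automorphic descent method as developed in [JZ15]. The method may be applied to" […] p0005:L6-9 "The goal of this paper is, under Assumption (depth assumption), to construct an even special orthogonal group $G_{n+1}$ such that $G_{n+1}\times H^{V_0}_1$ is a relevant pure inner form of $G_{n+1}^*\times H_1^*$, and construct an irreducible cuspidal automorphic representation $\pi_{n+1}$ of $G_{n+1}(\BA)$ such that $\pi_{n+1}$ has a generic Arthur parameter and has a non-zero Bessel period with respect to $\sigma$. The more precise explanation is in order." THEOREM 1.2: p0005:L36-37 "Theorem 1.2. Let $\tau$ and $\sigma$ be as given above."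 p0005:L39 "(a) There exists $\beta\in F^\times$ such that the twisted descent $\pi_\beta=\CD_{\psi_n,\beta}(\CE_{\tau\otimes\sigma})\neq 0$." p0005:L41-43 "(b) If $\sigma$ satisfies Assumption (depth assumption), then $\pi_\beta=\bigoplus_{i} \pi_\beta^{(i)}$ is a multiplicity free direct sum of irreducible cuspidal automorphic representations $\pi_\beta^{(i)}$ of $\SO_{2n+2,\beta}(\BA)$. Moreover, if $\omega_\tau=1$ and the $\beta\in F^\times$ in Part (a) is not a square, or if $\omega_\tau\neq 1$ and the $\beta\in F^\times$ in Part (a) is a square, then the same result holds without the above assumption." p0005:L45-48 "(c) Assume $\omega_{\tau}=1$, and the $\beta\in F^\times$ in Part (a) is not a square. Then each irreducible component $\pi_\beta^{(i)}$ of $\pi_{\beta}$ belongs to a global Arthur packet with a generic global Arthur parameter $\phi^{(i)}$. The parameter $\phi^{(i)}$ has the central character $\eta_{V_{0,\beta}}$, and has the property that $L(\frac{1}{2}, \phi^{(i)}\times\phi_{\tau_0})\neq 0$ and $(\pi_{\beta}^{(i)}, \sigma)$ has a non-zero Bessel period." with THEOREM 6.3: p0021:L64-66 "Theorem 6.3.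 Let $\tau=\tau_1 \boxplus \cdots \boxplus \tau_r$ be an irreducible isobaric sum automorphic representation of $\GL_{2n}(\BA)$ with trivial central character, such that each $\tau_i$ is a unitary irreducible cuspidal representation of $\GL_{n_i}(\BA)$ of orthogonal type. Let $V_0$ be a quadratic space of dimension $3$ over $F$, and $\sigma$ be an irreducible cuspidal automorphic representation of $\SO(V_0)(\BA)$ which lies in the global Vogan packet $\wt\Pi_{\phi_{\tau_0}}[H_1^*]$ (here $H_1^*=\SO_3^*$, $F$-split) for some irreducible cuspidal automorphic representation $\tau_0$ of $\GL_2(\BA)$ of symplectic type." […] [cite: JiangLiuXu2020Reciprocal, Thm 1.2 (p0005:L36-48), Thm 6.3 (p0021:L64-66), §1 (p0005:L6-9)] -/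
  JLXReciprocal : Prop

variable (ν : Nodes) (μ : Mok2015.Nodes) (κ : KMSW2014.Nodes) (c : Consumers) (c₈ : Consumers8) (c₆₅ : Consumers65)

-- Verbatim, the bibliography entries.
-- C176 (`paper:arxiv-1207.6724`): p0090:L25-27 "[arthur:classical] James Arthur, The endoscopic classification of representations: Orthogonal and symplectic groups, preprint." / p0091:L125-127 "[shin:galoisreps] Sug Woo Shin, Galois representations arising from some compact Shimura varieties, Ann. of Math. (2) 173 (2011), no. 3, 1645–1741."
-- C51 (`paper:arxiv-1406.3773`): p0012:L5 "[Ar] J. Arthur, The endoscopic classification of representations: Orthogonal and Symplectic Groups. Colloquium Publications, 61, 2013, AMS."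
-- C45 (`paper:arxiv-2107.10081`): p0037:L9 "[ar13] \bysame, \emph{{The endoscopic classification of representations. Orthogonal and symplectic groups}}, vol.~61, Providence, RI: American Mathematical Society (AMS), 2013." / p0038:L33 "[sch15] \bysame, \emph{On torsion in the cohomology of locally symmetric varieties}, Ann. of Math. (2) \textbf{182} (2015), no.~3, 945--1066."
-- C38 (`paper:doi-10-1007-s40316-015-0056-0`): p0031:L15-18 "[A] J. Arthur, The endoscopic classification of representations : orthogonal and symplectic groups, Colloquium Publications of the American Mathematical Society, volume 61." / p0032:L17-20 "[Mo] C.P. Mok, Endoscopic classification of representations of quasi-split unitary groups, à paraı̂tre dans Memoirs of the American Mathematical Society." / p0031:L66 "[KMSW] T. Kaletha, A. Minguez, S.W. Shin, P.J. White, Endoscopic Classification of Representations : Inner Forms of Unitary Groups, prépublication (2014)."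
-- C56 (`paper:arxiv-1812.03162`): p0023:L12-14 "[A] J. Arthur, The Endoscopic Classification of Representations: Orthogonal and Symplectic Groups, American Mathematical Society Colloquium Publications, 2013." / p0023:L74-75 "[JZ15] D. Jiang and L. Zhang, Arthur parameters and cuspidal automorphic modules, arXiv:1508.03205 [math.NT]."

/-- C176 ⇐ THE BOOK (`paper:arxiv-1207.6724`).  THE PLACE ARTHUR IS INVOKED, proof of Lemma 8.0.7: p0040:L33 "This follows from Arthur's classification of automorphic representations of classical groups ( [arthur:classical]). Namely, $\rho^\vee \cong \rho$ implies that $\pi^\vee \cong \pi$, and $\det(\rho)=1$ implies that $\omega_{\pi}=1$. $\pi$ is cuspidal, so the associated formal $A$-parameter $\phi$ (see $1.4$ of [arthur:classical]) is simple generic and so comes from a unique simple twisted endoscopic datum $G_\phi$ as in Theorem $1.4.1$ of [arthur:classical]; since $2n+1$ is odd, the parameter $\phi$ therefore factors through either $\mr{SO}_{2n+1}(\CC)$ or $\mr{O}_{2n+1}(\CC)$, but the latter case is ruled out since $\omega_\pi=1$. It follows that $G_\phi= \mr{Sp}_{2n}/F$." […]; and §8's construction: p0041:L30 "The construction of geometric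 $\rho \colon \gal{F} \to \mr{SO}_{2n+1}(\Qlb)$ having no geometric lift to $\mr{GSpin}_{2n+1}(\Qlb)$ (and with specified local behavior) follows as in Lemma (limmult), applying Clozel's limit multiplicity formula to $G= \mr{Sp}_{2n}/F$, transferring these forms to $\mr{GL}_{2n+1}$ (via [arthur:classical]), and then invoking the Paris Book Project, or, more precisely, Remark $7.6$ of [shin:galoisreps]." — [arthur:classical] = the book (cited as « preprint » in the 2012 bibliography, published 2013; the memoir appeared in 2019): the descent of a self-dual cuspidal π of GL_{2n+1} with ω_π = 1 to Sp_{2n} (§1.4, Theorem 1.4.1: simple generic parameters and their twisted endoscopic data) and the transfer Sp_{2n} → GL_{2n+1}, every n ↦ `∀ N, ν.Everything N`.  Lemma 8.0.6 is [blggt:potaut] Theorem C (Barnet-Lamb – Gee – Geraghty – Taylor: Arthur-free, absorbed); Clozel's limit multiplicity formula, [shin:galoisreps] and the Paris Book Project: Arthur-free, absorbed.  No status sentence anywhere in the 92 chunks (grep conditional / stabiliz / twisted trace formula → 0 relevant).  Premise: the book (all ranks). [cite: Patrikis2019Variations, §8 (p0040:L33, p0041:L30); Arthur2013, as [arthur:classical]]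 -/
def E_PatrikisTate : Prop := (∀ N, ν.Everything N) → c₆₅.PatrikisTate

/-- C51 ⇐ THE BOOK (`paper:arxiv-1406.3773`).  PROOF OF PROPOSITION 8.2: p0010:L77-77 "Proof. The representation $\Pi$ belongs to the automorphic $L^2$-spectrum. We shall now argue that $\Pi$ is a cuspidal automorphic representation if" […] p0010:L86-87 "with bounded image. In Theorem 1.5.1 in [Ar], to every such $\psi$, Arthur attaches a set (a packet) of unitary representations of $G$ over $F$, in fact, local constituents of automorphic representations. By the strong approximation" […] p0010:L91-93 "By Lemma 7.1.1 in [Ar], the involution on the set of parameters $\psi$ given by the switching of the two $SU(2)$ corresponds to the Aubert involution on representations. Since the Aubert involution of the trivial representation is the Steinberg representation, the Steinberg representation is contained in its $L$-packet and in no other packets." p0010:L95 "The local components of $\sigma$ sit in the packets determined by the local components of $\Pi$." […] p0010:L97-99 "packets parameterized by a larger set, denoted by $\Psi^+_{\unit}(G)$ by Arthur. According to the displayed formula (1.5.1) in [Ar] the packets in $\Psi^+_{\unit}(G)$, but not in $\Psi(G)$, consist of representations fully induced from a proper parabolic subgroup. In particular, the Steinberg representation cannot be in any of these packets." […] p0011:L1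 "Since the lift $\Pi$ is cuspidal, it is a functorial lift of $\sigma$. Summarizing, there exits a cusp form on $GL_7$ to which we can apply Corollary (C:G2). Thus, the image of the associated $p$-adic representation is contained in $G_2(\mathbb Q_p)$ for all $p\neq 5$." — [Ar] = the book: Theorem 1.5.2 (the lift of a cuspidal σ on Sp_{2n} to GL_{2n+1}), Theorem 1.5.1 (local packets), formula (1.5.1) (the packets of Ψ⁺_unit), Lemma 7.1.1 (Aubert involution), for Sp_6 and stated for every Sp_{2n} ↦ `∀ N, ν.Everything N`.  [GS] (Gross – Savin: the G_2 form and its lift to Sp_6 by an exceptional theta correspondence), [Ta] (Taylor), Aschbacher's classification, Chebotarev: Arthur-free, absorbed.  The sentence p0010:L96 (the generalized Ramanujan conj. is not known, whence Ψ⁺_unit) is cited by locator only.  No status sentence (census G-i, CONFIRMED).  Premise: the book (all ranks). [cite: MagaardSavin2020G2, §8 (p0010:L72-100, p0011:L1); Arthur2013, as [Ar]] -/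
def E_MagaardSavinG2 : Prop := (∀ N, ν.Everything N) → c₆₅.MagaardSavinG2

/-- C45 ⇐ THE BOOK ∧ C12 (`paper:arxiv-2107.10081`).  REMARK 5, the authors' own sentence: p0008:L40-41 "Remark 5. One could prove the above result by adapting the arguments in Chapter IV of [sch15]. The main technical point one needs to deal with is the construction of ad hoc compactifications of Hilbert modular varieties[This is slightly subtle because Hilbert modular varieties are Shimura varieties of abelian type and do not directly embed into Siegel modular varieties. However, one can handle this issue by carefully choosing the tame level.]. For the sake of brevity, we will instead explain below how to deduce the theorem from (a special case of) the main result of [sch15]; however, at the time of writing, the totally real case of the latter is conditional on Arthur's work [ar13]." — [sch15] = P. Scholze, Ann. of Math. 182 (2015) = row C12 ↦ `Consumers.ScholzeTR` (tranche 1: ⇐ book ∧ Mok; the special case used here is the Siegel case over a totally real field, whose conditionality the authors name: [ar13] = the book ↦ `∀ N, ν.Everything N`, typed as a premise of its own because the authors name it); the deduction: p0009:L5 "We deduce that $H^i(\bar{X}_K(G), k)_{\m(\psi)}\neq 0$, hence we have a Galois representation $\bar{\rho}_{\m(\psi)}$ attached to $\m(\psi)$ by [sch15]. We can finally take $\bar{\rho}_\m$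 to be the twist of $\bar{\rho}_{\m(\psi)}$ by the character of $\Gamma_F$ corresponding to $\psi$ via global class field theory."  [ddt], Dimitrov, Freitas, Boxer – Calegari – Gee – Pilloni, Caraiani – Scholze: Arthur-free, absorbed.  Premises: the book (all ranks), `ScholzeTR`. [cite: CaraianiTamiozzo2023, Rem. 5 (p0008:L40-41), §2.2 (p0009:L5); Scholze2015, as [sch15]; Arthur2013, as [ar13]] -/
def E_CaraianiTamiozzoTorsion : Prop := (∀ N, ν.Everything N) → c.ScholzeTR → c₆₅.CaraianiTamiozzoTorsion

/-- C38 ⇐ THE BOOK ∧ MOK (`paper:doi-10-1007-s40316-015-0056-0`).  THE STATUS SENTENCE (§3.11): p0018:L8-13 "3.11. Représentations galoisiennes. — Le résultats du paragraphe précédent est spécialement intéressant lorsqu’on sait que les systèmes de valeurs propres de Tp−ad sont associés à des représentations galoisiennes. C’est le cas lorsque G est égal à GSp4 ([L2], [T] et [W]), Sp2g sur un corps totalement réel [A] ou un groupe unitaire sur un corps CM ([Mo] et [KMSW]), ces trois dernières références étant conditionnelles à la stabilisation de la formule des traces tordue (mais voir les travaux récents de Waldspurger et Moeglin). On s’attend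 de plus à ce que ce soit le cas lorsque G = GSp2g sur un corps totalement réel (voir [X])." — [A] = the book (Sp_2g over a totally real field: the transfer to GL_{2g+1} and the Galois representations it yields, every g) ↦ `∀ N, ν.Everything N`; [Mo] = Mok's memoir ↦ `∀ N, μ.Everything N`; [KMSW] is named for « un groupe unitaire sur un corps CM », but the statement proved is the quasi-split case: p0019:L3-5 "3.12.1. Cas unitaire quasi-déployé. — Soit G un groupe unitaire quasi-déployé associé à F/F + un corps CM. On se place dans le cas où G est forme de GL2g /F . Le cas d’une forme de GL2g+1 /F marcherait tout aussi bien avec des énoncés légèrement adaptés. On" […] — so KMSW is NOT a premise of the typed edge (declared; the census graded the sentence B-Ar / B-Mok / B-KMSW); the Siegel – Hilbert case: p0018:L14-15 "3.11.1. Cas Siegel-Hilbert. — Formulons le résultat obtenu dans le cas où G = Sp2g sur un corps totalement réel F , qui concerne donc les variétés de Hilbert-Siegel connexes. Soit" […]; [L2], [T], [W] (Laumon, Taylor, Weissauer for GSp_4), [S4] (Scholze's torsion paper, for the method — not for a transfer), [X] (B. Xu, expected GSp_2g case, not used): Arthur-free or not invoked, absorbed.  Premises: the book (all ranks), Mok (all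 ranks). [cite: PilloniStroh2016, §3.11 (p0018:L8-15), §3.12.1 (p0019:L3-5); Arthur2013, as [A]; Mok2012, as [Mo]] -/
def E_PilloniStrohGalois : Prop := (∀ N, ν.Everything N) → (∀ N, μ.Everything N) → c₆₅.PilloniStrohGalois

/-- C56 ⇐ THE BOOK ∧ THE CHAPTER-9 NODE ∧ C16 (`paper:arxiv-1812.03162`).  THE SETUP: p0003:L24 "Following [A], we denote by $G_n^*:=\SO_{2n}^{\epsilon}$ an $F$-quasi-split special even orthogonal group, and denote by $H_m^*:=\SO_{2m+1}^*$" […] p0003:L27-29 "As in [A] and [GGP12], we denote by $G_n$ and $H_m$ a pure inner form of $G_n^*$ and $H_m^*$, respectively. Note that $G_n$ and $G_n^*$ share the same Langlands $L$-group, and so do $H_m$ and $H_m^*$. We recall the global Arthur parameters from [A], and consider the generic ones mostly. A generic global Arthur parameter for $G_n^*$ is given as a formal sum" […]; the descent target: p0005:L27 "Note that it could be either $F$-split, quasi-split or non-quasi-split," […]; THE ARGUMENT FOR THEOREM 1.2 (c): p0006:L3-7 "Let $\pi_\beta^{(i)}$ be an irreducible component of the descent $\pi_\beta$, which is cuspidal.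 By the unramified structure and the endoscopic classification of Arthur ( [A]), $\pi_{\beta}^{(i)}$ has a generic Arthur parameter $\phi^{(i)}$. By unfolding of Eisenstein series as used in [JZ15], we can show that the Bessel period for $(\pi_\beta^{(i)},\sigma)$ is non-zero. Note that the main result of [JZ15] also tells that the central value $L(\frac{1}{2}, \phi^{(i)}\times\phi_{\tau_0})$ is also non-zero (see (GGP))."; §6: p0021:L52 "By the endoscopic classification theory of Arthur [A], if $\pi$ has a non-generic global Arthur parameter, then $\pi_v$ is non-generic for almost all finite places." p0021:L57-59 "From the discussion right before Proposition (FCfordescent), the pair $(\pi,\sigma)$ has a non-zero Bessel period, and hence by Theorem 5.7 of [JZ15], one has that $L(\frac{1}{2}, \phi_{\pi}\times\phi_{\tau_0})\neq 0$." — [A] = the book: the global generic packets of the quasi-split SO_{2n+2,β}, SO^{V_0}_{4n+3} and of their PURE INNER FORMS (« non-quasi-split » targets and the pure inner forms H_m of p0003:L27): the quasi-split part at every rank ↦ `∀ N, ν.Everything N`, the inner forms ↦ the register's Chapter-9 node `Consumers8.InnerTwists` (the book's promised inner-twist volume, [A, Ch. 9]); [JZ15] = D. Jiang – L. Zhang,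 *Arthur parameters and cuspidal automorphic modules*, Ann. of Math. 191 (2020) = row C16 ↦ `Consumers8.JZmain` (its Theorem 5.7 and the unfolding method; tranche 8: hypothesis-on-π form for pure inner forms, ⇐ book ∧ Mok ∧ KMSW's scope ∧ `InnerTwists`).  [GGP12] (the conj., cited as motivation: line comment only by locator p0003:L21), [GGS17] (Gomez – Gourevitch – Sahi), [JLS16], [GRS11], [M11]: Arthur-free, absorbed.  The hypothesis that σ lies in a global Vogan packet is part of the typed statement (Theorem 6.3's text), not a premise.  Premises: the book (all ranks), `InnerTwists`, `JZmain`. [cite: JiangLiuXu2020Reciprocal, §1 (p0003:L24-29, p0005:L27, p0006:L3-7), §6 (p0021:L52, L57-59); JiangZhang2020, as [JZ15]; Arthur2013, as [A]] -/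
def E_JLXReciprocal : Prop := (∀ N, ν.Everything N) → c₈.InnerTwists → c₈.JZmain → c₆₅.JLXReciprocal

/-- The sixty-fifth tranche of implications: C176's edge, C51's, C45's, C38's, C56's. [cite: Patrikis2019Variations, Lemma 8.0.7; MagaardSavin2020G2, Prop. 8.2; CaraianiTamiozzo2023, Thm 4; PilloniStroh2016, Cor. 3.12; JiangLiuXu2020Reciprocal, Thm 1.2 (each edge's source in its own docstring)] -/
structure Implications65 : Prop where
  patrikis : E_PatrikisTate ν c₆₅
  magaardSavin : E_MagaardSavinG2 ν c₆₅
  caraianiTamiozzo : E_CaraianiTamiozzoTorsion ν c c₆₅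
  pilloniStroh : E_PilloniStrohGalois ν μ c₆₅
  jlx : E_JLXReciprocal ν c₈ c₆₅

variable {ν μ κ c c₈ c₆₅}

/-- THE WHOLE TRANCHE GIVEN THE CLASSIFICATIONS' OUTPUTS, THE CHAPTER-9 NODE AND THE TYPED ROWS. [cite: Patrikis2019Variations, Lemma 8.0.7; MagaardSavin2020G2, Thm 8.3; CaraianiTamiozzo2023, Thm 4; PilloniStroh2016, Cor. 3.12 / 3.13; JiangLiuXu2020Reciprocal, Thm 1.2 (bookkeeping proved here)] -/
theorem galoisIII_of_rows (Z : Implications65 ν μ c c₈ c₆₅) (hν : ∀ N, ν.Everything N) (hμ : ∀ N, μ.Everything N)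
    (h₁₂ : c.ScholzeTR) (h9 : c₈.InnerTwists) (h₁₆ : c₈.JZmain) :
    c₆₅.PatrikisTate ∧ c₆₅.MagaardSavinG2 ∧ c₆₅.CaraianiTamiozzoTorsion ∧ c₆₅.PilloniStrohGalois ∧ c₆₅.JLXReciprocal :=
  ⟨Z.patrikis hν, Z.magaardSavin hν, Z.caraianiTamiozzo hν h₁₂, Z.pilloniStroh hν hμ, Z.jlx hν h9 h₁₆⟩

/-- C176 AND C51 FROM THE BOOK'S INPUTS ALONE. [cite: Patrikis2019Variations, Lemma 8.0.7; MagaardSavin2020G2, Prop. 8.2 (bookkeeping proved here)] -/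
theorem galoisIII_bookRows_of_inputs (Z : Implications65 ν μ c c₈ c₆₅) (A : BookInputs ν) :
    c₆₅.PatrikisTate ∧ c₆₅.MagaardSavinG2 :=
  ⟨Z.patrikis A.everything, Z.magaardSavin A.everything⟩

/-- C176 AND C51 IN CONDITIONAL FORM, 2026: granting the book's edges, supply edges and every PUBLISHED input, the two theorems follow from the book's
seven 2024–2026 PREPRINT leaves and its two UNWRITTEN weighted fundamental lemmas — neither paper prints a status sentence (C176's bibliography
has « preprint »). [cite: Patrikis2019Variations, p0090:L25-27; MagaardSavin2020G2, p0012:L5 (bookkeeping proved here)] -/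
theorem galoisIII_bookRows_conditional_form (Z : Implications65 ν μ c c₈ c₆₅) (B : ν.BookEdges) (S : ν.SupplyEdges) (P : ν.PublishedLeaves) :
    ν.PreprintLeaves2026 → ν.UnwrittenLeaves → c₆₅.PatrikisTate ∧ c₆₅.MagaardSavinG2 :=
  fun Q U => galoisIII_bookRows_of_inputs Z ⟨B, S, P, Q, U⟩

/-- C45 AND C38 FROM THE BOOK'S AND MOK'S INPUTS: with tranche 1's edge (C12 ⇐ book ∧ Mok), Caraiani – Tamiozzo's Theorem 4 and Pilloni – Stroh's
Corollaires 3.12 / 3.13 follow from `BookInputs` and `MokInputs`. [cite: CaraianiTamiozzo2023, Thm 4; PilloniStroh2016, Cor. 3.12 / 3.13 (bookkeeping proved here)] -/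
theorem galoisIII_mokRows_of_inputs (Z : Implications65 ν μ c c₈ c₆₅) (I : Implications ν μ κ c) (A : BookInputs ν) (M : MokInputs μ) :
    c₆₅.CaraianiTamiozzoTorsion ∧ c₆₅.PilloniStrohGalois :=
  ⟨Z.caraianiTamiozzo A.everything (scholzeTR_of_leaves I A M), Z.pilloniStroh A.everything M.everything⟩

/-- C45 AND C38 IN CONDITIONAL FORM, 2026: granting the book's and Mok's edges, supplies and every PUBLISHED input (the twisted stabilisation both
papers name among them), the two theorems follow from the book's seven PREPRINT leaves and two UNWRITTEN weighted lemmas and from Mok's PREPRINT layer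
and Mok's two weighted lemmas — none of which either status sentence names. [cite: CaraianiTamiozzo2023, Rem. 5 (p0008:L41); PilloniStroh2016, §3.11 (p0018:L8-11) (bookkeeping proved here)] -/
theorem galoisIII_mokRows_conditional_form (Z : Implications65 ν μ c c₈ c₆₅) (I : Implications ν μ κ c) (B : ν.BookEdges) (S : ν.SupplyEdges)
    (P : ν.PublishedLeaves) (MB : μ.SectionEdges) (MS : μ.SupplyEdges) (MP : μ.PublishedLeaves) :
    ν.PreprintLeaves2026 → ν.UnwrittenLeaves → μ.PreprintLeaves2026 → μ.WFL_general → μ.WFL_nonstandard →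
      c₆₅.CaraianiTamiozzoTorsion ∧ c₆₅.PilloniStrohGalois :=
  fun Q U hQ h6 h7 => galoisIII_mokRows_of_inputs Z I ⟨B, S, P, Q, U⟩ ⟨MB, MS, MP, hQ, ⟨h6, h7⟩⟩

/-- C56 FROM THE LEAVES AND THE CHAPTER-9 NODE: with tranche 8's edge (C16 `JZmain` ⇐ book ∧ Mok ∧ KMSW's scope ∧ `InnerTwists`), Jiang – Liu – Xu's
Theorem 1.2 follows from `BookInputs`, `MokInputs`, `KMSWInputs` and the Chapter-9 node — the book's inner-twist volume, unwritten in 2026. [cite: JiangLiuXu2020Reciprocal, Thm 1.2 with p0005:L27, p0006:L3-7 (bookkeeping proved here)] -/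
theorem jlx_of_leaves_and_ch9 (Z : Implications65 ν μ c c₈ c₆₅) (X₈ : Implications8 ν μ κ c₈) (A : BookInputs ν) (M : MokInputs μ)
    (K : KMSWInputs μ κ) (h9 : c₈.InnerTwists) : c₆₅.JLXReciprocal :=
  Z.jlx A.everything h9 (jzmain_of_leaves_and_ch9 X₈ A M K h9)

/-- C56 IN CONDITIONAL FORM on the book side, 2026 (Mok's and KMSW's inputs granted in full): the book's preprint layer, its two unwritten weighted
fundamental lemmas AND the Chapter-9 node — unflagged in the paper (which flags only its hypothesis on σ). [cite: JiangLiuXu2020Reciprocal, p0005:L27 (« non-quasi-split »), p0006:L4 (bookkeeping proved here)] -/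
theorem jlx_conditional_form (Z : Implications65 ν μ c c₈ c₆₅) (X₈ : Implications8 ν μ κ c₈) (B : ν.BookEdges) (S : ν.SupplyEdges)
    (P : ν.PublishedLeaves) (M : MokInputs μ) (K : KMSWInputs μ κ) :
    ν.PreprintLeaves2026 → ν.WFL_general → ν.WFL_nonstandard → c₈.InnerTwists → c₆₅.JLXReciprocal :=
  fun hQ h6 h7 h9 => jlx_of_leaves_and_ch9 Z X₈ ⟨B, S, P, hQ, ⟨h6, h7⟩⟩ M K h9

/-- THE WHOLE TRANCHE FROM THE LEAVES OF THE THREE DAGS AND THE CHAPTER-9 NODE. [cite: Patrikis2019Variations, Lemma 8.0.7; MagaardSavin2020G2, Thm 8.3; CaraianiTamiozzo2023, Thm 4; PilloniStroh2016, Cor. 3.12 / 3.13; JiangLiuXu2020Reciprocal, Thm 1.2 (bookkeeping proved here)] -/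
theorem galoisIII_of_leaves_and_ch9 (Z : Implications65 ν μ c c₈ c₆₅) (I : Implications ν μ κ c) (X₈ : Implications8 ν μ κ c₈) (A : BookInputs ν)
    (M : MokInputs μ) (K : KMSWInputs μ κ) (h9 : c₈.InnerTwists) :
    c₆₅.PatrikisTate ∧ c₆₅.MagaardSavinG2 ∧ c₆₅.CaraianiTamiozzoTorsion ∧ c₆₅.PilloniStrohGalois ∧ c₆₅.JLXReciprocal :=
  have b := galoisIII_bookRows_of_inputs Z A
  have m := galoisIII_mokRows_of_inputs Z I A M
  ⟨b.1, b.2, m.1, m.2, jlx_of_leaves_and_ch9 Z X₈ A M K h9⟩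

/-! ## Sixty-sixth tranche (v3, unit `pub-arthur-down-g30`): THE UNITARY LINE — FIVE CONSUMERS OF MOK'S MEMOIR: C58 `GrbacShahidiAsai`,
C52 `JZUnitaryNonvanishing`, C54 `IchinoThetaReal`, C53 `FinisLapidTWN`, E7 `ATLevelRaising`

Context (`DOWNSTREAM.md` rows C58 l.212, C52 l.206, C54 l.208, C53 l.207, E7 l.228 `[g2]` — graded, never typed); no typed consumer row is a
premise this tranche (KMSW's nodes `Scope`, `Full`, `StabOrdI` are DAG nodes of `KMSW2014.Nodes`); block `[g30f]` of `DOWNSTREAM3.md`.  Texts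
staged under `HOME/pub-arthur-down-g30/primaries/`: `paper:doi-10-2140-pjm-2015-276-185` (C58, PDF text 31 pp.), `paper:arxiv-1806.04340` (C52,
TeX 18 chunks), `paper:arxiv-2002.09148` (C54, TeX 27 chunks), `paper:arxiv-1603.05475` (C53, TeX 26 chunks), `paper:arxiv-1912.11267` (E7, TeX 19
chunks).  Loci: C58 p0002:L8, L30-33, p0003:L13-49, p0016:L5-9, p0017:L8, L24, p0018:L33-35, p0020:L6-7, L38-39, p0027:L14-15; C52 p0003:L3-6, L24,
L29-31, L58-59, p0004:L15-16, p0005:L1-2, L12, p0006:L105-106, p0007:L50, L59, p0008:L7-11, p0012:L11-14, p0013:L16-21, p0018; C54 p0002:L3,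
p0003:L27-33, L45-46, L49, L61, p0004:L1, L31-32, p0016:L94-96, p0017:L40, p0019:L109, L131, p0026; C53 p0002:L3-7, p0003:L12-14, L51-69,
p0015:L137-149, p0018:L53-62, p0020:L91-101, p0023:L21-23, p0025:L128-129; E7 p0002:L3, p0003:L36-55, p0004:L1-11, p0009:L1-3, p0010:L40,
p0011:L3, L33, p0012:L13, p0017:L5-22, p0018:L5, L47, L55, L61. -/

/-- Rows C58, C52, C54, C53, E7 of the census, as an arbitrary assignment of propositions; nothing about the content of a field is assumed. [cite: Arthur2013, downstream register of the cell, sixty-sixth tranche (structure only)] -/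
structure Consumers66 where
  /-- C58 (census grade G-ii): Neven Grbac – Freydoon Shahidi, *Endoscopic transfer for unitary groups and holomorphy of Asai L-functions*, Pacific J. Math. 276 (2015) no. 1, 185–211, doi:10.2140/pjm.2015.276.185 (corpus PDF text `paper:doi-10-2140-pjm-2015-276-185`, 31 pp.; E/F a quadratic extension of number fields) — p0002:L8 "The analytic properties of the complete Asai L-functions attached to cuspidal automorphic representations of the general linear group over a quadratic extension of a number field are obtained." p0002:L30-33 "a quadratic extension of a number field. The approach is based on the Langlands– Shahidi method, combined with the knowledge of the poles of Eisenstein series coming from a recent endoscopic classification of automorphic representations of the quasisplit unitary groups by Mok [2015]." […] THEOREM 4.3: p0003:L13-14 "Theorem 4.3. Let σ be a cuspidal automorphic representation of GLn (A E ). Let L(s, σ, rA ) (respectively, L(s, σ ⊗ δ̂, rA )) be the Asai (respectively, twisted Asai)" […] p0003:L21-29 "(1) If σ is not Galois self-dual, i.e., if σ 6∼ = σ̃ θ , then L(s, σ, rA ) is entire. It is nonzero for Re(s) ≥ 1 and Re(s) ≤ 0. (2) If σ is Galois self-dual, i.e., if σ ∼ = σ̃ θ , then (a) L(s, σ, rA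 ) is entire, except for possible simple poles at s = 0 and s = 1, and nonzero for Re(s) ≥ 1 and Re(s) ≤ 0; (b) exactly one of the L-functions L(s, σ, rA ) and L(s, σ ⊗ δ̂, rA ) has simple poles at s = 0 and s = 1, while the other is holomorphic at those points." [cite: GrbacShahidi2015, Thm 4.3 (p0003:L13-29), abstract (p0002:L8, L30-33)] -/
  GrbacShahidiAsai : Prop
  /-- C52 (census grade: partial — hypothesis-on-π form, no status sentence): Dihua Jiang – Lei Zhang, *On the non-vanishing of the central value of certain L-functions: unitary groups*, J. Eur. Math. Soc. 22 (2020) no. 6, 1759–1783, doi:10.4171/jems/955 = arXiv:1806.04340 (corpus TeX `paper:arxiv-1806.04340`, 18 chunks) — THE SETUP: p0003:L3-6 "Let $F$ be a number field, and $G_n^*$ be an $F$-quasisplit unitary group that is either $\RU_{n,n}$ or $\RU_{n+1,n}$. For an irreducible cuspidal automorphic representation $\pi$ of $G_n^*(\BA)$, where $\BA$ is the ring of adeles of $F$, we assume that $\pi$ has a generic global Arthur parameter ( [A13] and [Mk15]) and consider the non-vanishing problem of $L(\frac{1}{2},\pi\times\chi)$, the central value of the tensor product $L$-function of $\pi$ with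 an automorphic character $\chi$ of $\RU_1$." the non-vanishing assertion of their §1 (p0003:L28, whose body is): p0003:L29-31 "For any given generic global Arthur parameter $\phi$ of $G_n^*$, there exists an automorphic character $\chi$ of $\RU_1$ such that for every automorphic member $\pi$ in the global Arthur packet $\wt{\Pi}_\phi(G_n^*)$ associated to $\phi$, the central value $L(\frac{1}{2},\pi\times\chi)$ of the tensor product $L$-function of $\pi$ and $\chi$ is nonzero." — THEOREM 1.3 (p0003:L58-59, by locator: the assertion holds for the F-quasisplit U_{1,1}, U_{2,1}, U_{2,2}) with THEOREM 5.1: p0013:L16-17 "Theorem 5.1. For any irreducible generic cuspidal automorphic representation $\pi$ of $\RU_{2,2}(\BA)$, there exists an automorphic character $\chi$ of $\RU_1(\BA)$ such that" L(1/2, π × χ) ≠ 0 [display p0013:L19-21]; THEOREM 4.4 (and 1.5 / 4.6, under their Fourier-coefficient hypothesis for U_{n+2,n}, p0012:L12 by locator): p0012:L11 "Theorem 4.4." […] p0012:L13-14 "For any generic global Arthur parameter $\phi$ of $\RU_{n+1,n}$, which is $F$-quasisplit, there exists an automorphic character $\chi$ of $\RU_1(\BA)$ such that the central value of the tensor product $L$-function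 $L(\frac{1}{2},\pi\times\chi)$ is nonzero for all automorphic members $\pi\in\wt{\Pi}_\phi(\RU_{n+1,n})$." [cite: JiangZhang2020Nonvanishing, Thm 1.3 (p0003:L58-59), Thm 5.1 (p0013:L16-21), Thm 4.4 (p0012:L11-14), §1 (p0003:L3-6, L29-31)] -/
  JZUnitaryNonvanishing : Prop
  /-- C54 (census grade: FLAGGED K1, explicit): Atsushi Ichino, *Theta lifting for discrete series representations of real unitary groups*, arXiv:2002.09148 (2020; corpus TeX `paper:arxiv-2002.09148`, 27 chunks), published in extended form as *Theta lifting for tempered representations of real unitary groups*, Adv. Math. 409 (2022) 108188, doi:10.1016/j.aim.2022.108188 (the typed statement is the arXiv version's, the discrete-series case) — ABSTRACT: p0002:L3 "We study the theta lifting for real unitary groups and completely determine the theta lifts of discrete series representations." THEOREM 1.1: p0003:L27-29 "Theorem 1.1. Let $\pi$ be a discrete series representation of $\U(p,q)$. Assume that its theta lift $\theta_{r,s}(\pi)$ to $\U(r,s)$ is nonzero." p0003:L31 "* If $p+q < r+s$, then $\theta_{r,s}(\pi)$ is a cohomologically induced representation $A_\q(\lambda)$ of $\U(r,s)$ in the weakly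 fair range, where $\q$ and $\lambda$ can be described explicitly." p0003:L33 "* If $p+q \ge r+s$, then $\theta_{r,s}(\pi)$ is a discrete series representation of $\U(r,s)$, where its Harish-Chandra parameter can be described explicitly." [cite: Ichino2022ThetaReal, Thm 1.1 of arXiv:2002.09148 (p0003:L27-33), abstract (p0002:L3)] -/
  IchinoThetaReal : Prop
  /-- C53 (census grade G-ii, complete): Tobias Finis – Erez Lapid, *On the analytic properties of intertwining operators I: global normalizing factors*, Bull. Iranian Math. Soc. 43 (2017) no. 4, 235–277 = arXiv:1603.05475 (corpus TeX `paper:arxiv-1603.05475`, 26 chunks) — ABSTRACT: p0002:L3-7 "We provide a uniform estimate for the $L^1$-norm (over any interval of bounded length) of the logarithmic derivatives of global normalizing factors associated to intertwining operators for the following reductive groups over number fields: inner forms of $\GL(n)$; quasi-split classical groups and their similitude groups; the exceptional group $G_2$. This estimate is a key ingredient in the analysis of the spectral side of Arthur's trace formula. In particular, it is applicable to the limit multiplicity problem studied by the authors in earlier papers." p0003:L12-14 "This paper is devoted to establishing property (TWN) in a number of other cases, namely for inner forms of the groups $\GL(n)$ and $\SL(n)$, for quasi-split classical groups and their similitude groups,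 and for the exceptional group $G_2$. In fact, we prove without any more effort a finer estimate (already mentioned in [MR3352530]), which we call property (TWN+)." THEOREM 3.11: p0015:L137-138 "Theorem 3.11. The following groups satisfy property (L), and hence also property (TWN+)." p0015:L140 "* $\GL (n)$ and its inner forms." p0015:L142 "* Quasi-split classical groups." p0015:L144 "* The exceptional group $G_2$." […] p0015:L148-149 "The proof is based on a case-by-case analysis of the $L$-functions appearing in the definition of property (L). The quasi-splitness assumption in part 3 comes from the fact that we use functoriality to $\GL (n)$, which at the moment is only available in this case." through THEOREM 5.1: p0018:L53-54 "Theorem 5.1. The following pairs $(G,r)$ satisfy properties (FE+) and :" […] p0018:L62 "* $G=G'\times\Res_{E/F}\GL (n)$, where $G'$ is a quasi-split classical group and $r=T_{m,n}\circ(\can_{G'}\otimes\id_n)$." [cite: FinisLapid2017Normalizing, Thm 3.11 (p0015:L137-149), Thm 5.1 (p0018:L53-62), abstract (p0002:L3-7), §1 (p0003:L12-14)] -/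
  FinisLapidTWN : Prop
  /-- E7 (census class E: explicit avoidance of the unwritten KMSW sequels): Christos Anastassiades – Jack A. Thorne, *Raising the level of automorphic representations of GL_{2n} of unitary type*, J. Inst. Math. Jussieu 21 (2022), doi:10.1017/S1474748020000602 = arXiv:1912.11267 (corpus TeX `paper:arxiv-1912.11267`, 19 chunks; E a CM field) — ABSTRACT: p0002:L3 "We use the endoscopic classification of automorphic representations of even-dimensional unitary groups to construct level-raising congruences." THEOREM 1: p0003:L36 "In this paper, we prove new level-raising results for regular algebraic automorphic representations of $\GL_n(\bA_E)$ of unitary type, with only a very weak condition on $\overline{r}_\iota(\pi)$." […] p0003:L38-39 "Theorem 1. Let $E$ be a CM number field, and let $n \geq 1$ be an integer. Let $\pi_1, \pi_2$ be cuspidal automorphic representations of $\GL_n(\bA_E)$ of unitary type such that $\pi = \pi_1 \boxplus \pi_2$ is regular algebraic. Let $l$ be a prime, and let $\iota : \overline{\bQ}_l \to \bC$ be an isomorphism. Suppose that the following conditions are satisfied:" […] p0003:L53 "Then we can find the following:" p0003:L55 "* A biquadratic CM extension $E' / E$, and a place $w' | w$ of $E'$." p0004:L1 "* A cuspidal automorphic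 representation $\Pi$ of $\GL_{2n}(\bA_{E'})$, regular algebraic of unitary type, such that $\overline{r}_\iota(\Pi) \cong \overline{r}_\iota(\pi)|_{\Gal(\overline{E} / E')}$ and $\Pi_{w'}$ is an unramified twist of the Steinberg representation of $\GL_{2n}(E'_{w'})$." and the general THEOREM 17: p0017:L5-6 "Theorem 17. Let $n \geq 1$ be an integer and let $E$ be a CM number field. Let $F$ be the maximal totally real subfield of $E$, and assume that $E / F$ is everywhere unramified. Let $l$ be a prime, and fix an isomorphism $\iota : \overline{\bQ}_l \to \bC$. Let $w_0$ be a prime-to-$l$ place of $E$ which splits over $F$. Let $\pi_1, \pi_2$ be cuspidal, conjugate self-dual automorphic representations of $\GL_n(\bA_{E})$ satisfying the following conditions:" […] p0017:L18 "Let $F' / F$ be any totally real, quadratic $w_0$-split extension, and let $E' = E F'$. Suppose further that $\overline{r}_\iota(\pi)|_{G_{E'}}$ is not isomorphic to a twist of $1 \oplus \epsilon^{-1} \oplus \dots \oplus \epsilon^{1-2n}$. Then there exists a RACSDC automorphic representation $\Pi$ of $\GL_{2 n}(\bA_{E'})$ and a place $w_0' | w_0$ of $E'$ satisfying the following conditions:"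 p0017:L20 "* There is an isomorphism $\overline{r}_\iota(\Pi) \cong \overline{r}_\iota(\pi)|_{G_{E'}}$." p0017:L22 "* There is an isomorphism $\Pi_{w'_0} \cong \St_{2n}(\xi')$, where $\xi' : E_{w'_0}^\times \to \bC^\times$ is an unramified character." […] [cite: AnastassiadesThorne2022, Thm 1 (p0003:L36-55, p0004:L1), Thm 17 (p0017:L5-24), abstract (p0002:L3)] -/
  ATLevelRaising : Prop

variable (ν : Nodes) (μ : Mok2015.Nodes) (κ : KMSW2014.Nodes) (c₆₆ : Consumers66)

-- Verbatim, sentences that name a conj. (kept out of docstrings) and the bibliography entries.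
-- C52 (`paper:arxiv-1806.04340`): p0003:L56 "The first main result of this paper is to prove Conjecture (conj-nvn1) for $F$-quasisplit unitary groups: $\RU_{1,1}$, $\RU_{2,1}$ and $\RU_{2,2}$." / THEOREM 1.3: p0003:L58-59 "Theorem 1.3. Conjecture (conj-nvn1) is true for $F$-quasisplit unitary groups: $\RU_{1,1}$, $\RU_{2,1}$ and $\RU_{2,2}$." / THEOREM 1.5: p0004:L15-16 "Theorem 1.5. Assume that Conjecture (conj-subr) holds. Then Conjecture (conj-nvn1) is true for all $F$-quasisplit unitary groups." / Thm 4.4's hypothesis: p0012:L12 "Assume that Conjecture (conj-subr) holds for unitary groups $\RU_{n+2,n}\in\CU_{n+2,n}$."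
-- C54 (`paper:arxiv-2002.09148`): p0004:L30 "To prove this proposition, we modify the argument of Atobe [atobe] for the nonvanishing of $\theta_{r,s}(\pi)$, which uses the Gan–Gross–Prasad conjecture partially proved by He [he]."
-- C58: p0027:L14-15 "[Mok 2015] C. P. Mok, “Endoscopic classification of representations of quasi-split unitary groups”, American Mathematical Society, Providence, RI, 2015. Mem. Amer. Math. Soc."
-- C52: p0018:L3-5 "[A13] Arthur, J.: The endoscopic classification of representations." / p0018:L75-77 "[KMSW] Kaletha, T., Minguez, A., Shin, S. W., White, P.-J.: Endoscopic Classification of Representations: Inner Forms of Unitary Groups." / p0018:L84 "[Mk15]"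
-- C54: p0026:L104-107 "[kmsw] T. Kaletha, A. Mínguez, S. W. Shin, and P.-J. White, Endoscopic classification of representations: inner forms of unitary groups, arXiv:1409.3731." / p0026:L15-18 "[arthur] J. Arthur, The endoscopic classification of representations: orthogonal and symplectic groups, American Mathematical Society Colloquium Publications 61, American Mathematical Society, Providence, RI, 2013." / p0026:L179-181 "[mok] C. P. Mok, Endoscopic classification of representations of quasi-split unitary groups,"
-- C53: p0023:L21-23 "[MR3135650] , The endoscopic classification of representations, American Mathematical Society Colloquium Publications, vol. 61, American Mathematical" / p0025:L128-129 "[MR3338302] Chung Pang Mok, Endoscopic classification of representations of"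
-- E7: p0018:L47 "[Kal14] Tasho Kaletha, Alberto Minguez, Sug~Woo Shin, and Paul-James White, \emph{Endoscopic classification of representations: Inner forms of unitary groups}, arXiv preprint." / p0018:L61 "[Mok15] Chung~Pang Mok, \emph{Endoscopic classification of representations of quasi-split unitary groups}, Mem. Amer. Math. Soc. \textbf{235} (2015), no.~1108, vi+248. \MR{3338302}" / p0018:L55 "[labesse] J.-P. Labesse, \emph{Changement de base {CM} et s\'{e}ries discr\`etes}, On the stabilization of the trace formula, Stab. Trace Formula Shimura Var. Arith. Appl., vol.~1, Int. Press, Somerville, MA, 2011, pp.~429--470. \MR{2856380}" / p0018:L5 "[Art13] James Arthur, \emph{The endoscopic classification of representations}, American Mathematical Society Colloquium Publications, vol.~61, American Mathematical Society, Providence, RI, 2013, Orthogonal and symplectic groups. \MR{3135650}"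

/-- C58 ⇐ MOK (`paper:doi-10-2140-pjm-2015-276-185`).  THE IDEA OF THE PROOF: p0003:L30-42 "The idea of the proof is to consider the Eisenstein series attached to σ on the quasisplit unitary group U2n (A F ) defined by the quadratic extension E/F, where σ is viewed as a representation of the Levi factor of the Siegel maximal parabolic subgroup of U2n in 2n variables. We look at the contribution of this Eisenstein series to the residual spectrum from two different points of view. On the one hand, by the Langlands–Shahidi method [2010], the poles of the Eisenstein series for the complex argument in the positive Weyl chamber are determined by certain ratio of the Asai L-functions. The residues at such a pole span a residual representation of U2n (A F ). On the other hand, this residual representation should have an Arthur parameter, according to Mok’s endoscopic classification [2015] of automorphic representations of quasisplit unitary groups (see also [Arthur 2005; 2013]). Comparing the possible Arthur parameters and poles of Asai L-functions, we are able to deduce the analytic properties of these L-functions."  THE STATUS SENTENCE: p0003:L43-49 "Mok’s work, as well as Arthur’s, still depends on the stabilization of the twisted trace formula for the general linear group. Hence, our result is also conditional on this stabilization. This issue is considered by Waldspurger [2014a; 2014b; 2014c]. In our paper, we always make a remark when a partial result could have been obtained without using Mok’s work. In fact, the crucial insight coming from endoscopic classification is holomorphy of the Asai L-function L(s, σ,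 rA ) inside the critical strip 0 < Re(s) < 1." — [Mok 2015] = the memoir: Theorem 2.5.4(a) (p0016:L5-9 "It turns out, as also proved by Mok, that this definition can be rephrased in terms of poles at s = 1 of the Asai L-function L(s, µ, rA ) attached to µ. Theorem 3.2 [Mok 2015, Theorem 2.5.4(a)]. Let µ be a Galois self-dual cuspidal automorphic representation of GLm (A E ). Then µ is Galois orthogonal (resp. Galois symplectic) if and only if the Asai L-function L(s, µ, rA ) (resp. the twisted Asai" […]), the packets and the discrete spectrum of U_2n and the comparison of trace formulas (p0017:L8 "3.B. Arthur packets. We proceed, following [Mok 2015], to define the local and" […] p0017:L24 "discrete spectrum (for a precise formulation see [Mok 2015, Theorem 2.5.2]). We" […] p0018:L33-35 "According to the preliminary comparison of spectral sides of the trace formulas for UN and the twisted trace formula for GL N , carried out in [Mok 2015, Section 4.3] (see also [Arthur 2013, Section 3.4]), for every irreducible automorphic representation π of UN (A F ) appearing in the discrete spectrum, there is a unique" […]), §4: p0020:L6-7 "In this section we prove the analytic properties of the Asai L-functions as a consequence of Mok’s endoscopic classification [2015] of automorphic representations of a quasisplit unitary group." […] p0020:L38-39 "without using Mok’s work on the Arthur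 classification for unitary groups [Mok 2015], which is based on the trace formula, and still depends on the stabilization of" […] — for U_2n and the base changes GL_m(𝔸_E), every n ↦ `∀ N, μ.Everything N`.  [Arthur 2005; 2013] is cited « see also » (the split analogue is Grbac 2011, a different theorem): no book premise.  The Langlands – Shahidi method [2010], Waldspurger [2014a–c] (named as addressing the stabilisation): Arthur-free or upstream, absorbed.  Premise: Mok (all ranks). [cite: GrbacShahidi2015, §1 (p0003:L30-49), §3 (p0016:L5-9, p0017:L8, L24, p0018:L33-35), §4 (p0020:L6-7, L38-39); Mok2012, as [Mok 2015]] -/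
def E_GrbacShahidiAsai : Prop := (∀ N, μ.Everything N) → c₆₆.GrbacShahidiAsai

/-- C52 ⇐ MOK ∧ KMSW's PROVED SCOPE (`paper:arxiv-1806.04340`).  THE TOOLS NAMED: p0003:L24 "* the endoscopic classification of the discrete spectrum as in [A13], [Mk15], and [KMSW]."; THE CLASSIFICATION AS RECALLED (Theorem 2.1 « ([A13], [Mk15], [KMSW]) », for the unitary groups G_n, pure inner forms included): p0008:L7-9 "Theorem 2.1 ([A13], [Mk15], [KMSW]). For any $\pi\in\CA_\disc(G_n)$, there is a $G_n$-relevant global Arthur parameter $\psi\in\wt{\Psi}_2(G_n^*,\xi)$, such that $\pi$ belongs to the global Arthur packet, $\wt{\Pi}_{\psi}(G_n)$, attached to the global Arthur parameters $\psi$." p0008:L11 "In the rest of this paper, we mainly consider the generic global Arthur parameters of $G_n^*$."; p0006:L105-106 "from the work of Arthur ( [A13]), the work of Mok ( [Mk15]) and the work of Kaletha, Minguez, Shin, and White ( [KMSW])." […] p0007:L50 "By [A13] and [Mk15], for a simple parameter $\phi=\phi^a=(\tau,1)$ in $\wt{\Phi}_\simp(a)$" […] p0007:L59 "By [Mk15],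 the (partial) $L$-function" […]; THE REDUCTION AND THE USE: p0005:L1-2 "With the endoscopic classification for general unitary groups ( [KMSW]) in mind, it is enough to treat the non-vanishing of the central values $L(\frac{1}{2},\pi\times\chi)$ for $F$-quasisplit unitary groups. For technical reasons, we" […] p0005:L12 "the simultaneous non-vanishing for general linear groups (Theorem (th-nvgl), i.e. Corollary (cor-smnv)) and for endoscopy groups (Theorem (th-nvug)), using the endoscopic classification of the discrete spectrum of quasisplit unitary groups ( [Mk15])." — [Mk15] = Mok's memoir (the F-quasisplit U_{n,n}, U_{n+1,n}, their generic global packets and L-functions, every n) ↦ `∀ N, μ.Everything N`; [KMSW] = the generic global packets of the NON-quasisplit U_{n+2,n} into which φ ⊞ φ_2 / φ ⊞ φ_1 are placed (Propositions 4.x) — generic parameters of unitary groups of Hermitian spaces, i.e. INSIDE KMSW's proved scope (Theorem* 1.7.1 for generic parameters) ↦ `∀ N, κ.Scope N` (typed by use, as rows C13 / C143; Theorem 2.1 as printed recalls the full classification — declared); [A13] = the book, cited with [Mk15] for the formalism of parameters: no book premise (the groups are unitary).  [JZ-BF], [JL-Cogdell], [GRS11], [J14], [JZ14]: the authors' own and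 Arthur-free inputs, absorbed; their Fourier-coefficient hypothesis (p0012:L12, p0004:L16 — line comments above) is part of the typed statements of Theorems 1.5 / 4.4 / 4.6, not a premise.  Premises: Mok (all ranks), KMSW's scope (all ranks). [cite: JiangZhang2020Nonvanishing, §1 (p0003:L24, p0005:L1-2, L12), §2 (p0006:L105-106, p0007:L50, L59, p0008:L7-11); Mok2012, as [Mk15]] [claim: KalethaMinguezShinWhite2014, under-review] -/
def E_JZUnitaryNonvanishing : Prop := (∀ N, μ.Everything N) → (∀ N, κ.Scope N) → c₆₆.JZUnitaryNonvanishing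

/-- C54 ⇐ MOK ∧ KMSW IN FULL (`paper:arxiv-2002.09148`).  THE CAVEAT: p0003:L45-46 "Our proof is global and relies on Arthur's endoscopic classification [arthur,mok,kmsw]. Namely, our main result is conditional on Arthur's multiplicity formula for the automorphic discrete spectra of unitary groups announced by Kaletha–Mínguez–Shin–White [kmsw] (see (eq:amf) below for details), whose proof will be completed in their subsequent work." — THE USE: p0003:L49 "This will be the input and output of Arthur's multiplicity formula." […] p0003:L61 "Then we use Arthur's multiplicity formula (viewed as a product formula) to transfer the information from the case of sufficiently regular infinitesimal character to the general case." p0004:L1 "To show that $G,H,\varPi$ as in (item:intro1) exist, we appeal to Arthur's multiplicity formula." §6.4: p0016:L94 "6.4 Arthur's multiplicity formula" p0016:L96 "In this subsection, we review Arthur's multiplicity formula for unitary groups [mok,kmsw], which is a key ingredient in the proof of Theorem (t:main)(item:main1)." […] p0017:L40 "Then Arthur's multiplicity formula [kmsw] says that" […] p0019:L109 "for all $i$, it follows from Arthur's multiplicity formula (eq:amf) that $\varPi$ is automorphic." […] p0019:L131 "Finally, we derive the information about $\varSigma_{v_0} = \theta_{r,s}(\pi)$ from the knowledge of $\varSigma_v$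 for $v \ne v_0$ and Arthur's multiplicity formula." — [kmsw] = Kaletha – Mínguez – Shin – White, arXiv:1409.3731: Arthur's multiplicity formula for the unitary groups U(V) of Hermitian spaces over a totally real field at ALL parameters (the global packets Π_ψ with ψ non-generic occur: the A_𝔮(λ) in the weakly fair range), « whose proof will be completed in their subsequent work » — the register's `∀ N, κ.Full N` (KMSW's starred theorems in full, both sequels included); [mok] = Mok's memoir (the quasi-split case and the local packets [mok, kmsw] of §6) ↦ `∀ N, μ.Everything N`; [arthur] = the book, cited in « Arthur's endoscopic classification [arthur,mok,kmsw] » for the formalism: no book premise (unitary groups only).  Proposition 1.2 and the non-vanishing application are local and unconditional (p0004:L31-32 "We stress that the proof is local and does not rely on Arthur's endoscopic classification. In particular, the result and its application to the nonvanishing of global theta lifts are unconditional."): not part of the typed edge's premises.  [atobe], [he], Li, Paul, Przebinda, Moeglin – Renard: Arthur-free or typed elsewhere, absorbed.  Premises: Mok (all ranks), KMSW in full (all ranks). [cite: Ichino2022ThetaReal, arXiv:2002.09148 §1 (p0003:L45-46, L49, L61, p0004:L1, L31-32), §6.4 (p0016:L94-96, p0017:L40), §7 (p0019:L109, L131); Mok2012,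 as [mok]] [claim: KalethaMinguezShinWhite2014, under-review] -/
def E_IchinoThetaReal : Prop := (∀ N, μ.Everything N) → (∀ N, κ.Full N) → c₆₆.IchinoThetaReal

/-- C53 ⇐ THE BOOK ∧ MOK (`paper:arxiv-1603.05475`).  THE METHOD: p0003:L51 "Our method of proving (TWN+) for the groups listed above, is to use functoriality to transfer the problem to a well-understood problem" […] p0003:L57-62 "In (SectionClassical), we will consider quasi-split classical groups. We first consider the twisted exterior and symmetric square $L$-functions for $\GL (n)$, as well as the Asai $L$-function for $\Res_{E/F}\GL (n)$, using known results obtained by the Langlands-Shahidi method and by the study of integral representations. Using Arthur's work on functoriality from the classical groups to $\GL (n)$ [MR3135650], extended by Mok to unitary groups [MR3338302], we will be able once again to reduce the remaining $L$-functions to Rankin-Selberg $L$-functions for $\GL (n)$."  THE STATUS PARAGRAPH (complete for 2016): p0003:L64-69 "Our approach is based on Arthur's work, which requires the full force of the stable twisted trace formula. Among the prerequisites of Arthur's results are [MR1687096, MR2979862, MR1444087, MR2437683, MR3026269, MR2448443, MR2418405, 1205.1100, 1401.4569, 1401.7127, 1402.2753, 1403.1454, 1404.2402, 1406.2257, 1409.0960,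 1410.1124, 1412.2565, 1412.2981], to mention a few. One may contemplate whether there is a different approach to the problem which avoids functoriality (and is perhaps applicable to other groups). Unfortunately, at the moment we cannot say anything in this direction."  THEOREM 5.5 AND ITS USE: p0020:L91 "We will need the following consequence of Arthur's work (taking also [MR2599005] into account).[We thank Colette Mœglin for helpful discussions on Arthur's local results in [MR3135650].]" p0020:L93-95 "Theorem 5.5 ([MR3135650], [MR3338302]). Any $\pi\in\Pi_{\disc}(G'(\A))$ admits a transfer $\Ar(\pi)\in\Pi_{\aut}(\GL(m,\A_E))$. Consequently, for any $n\ge1$ and any $\pi'\in\Pi_{\cusp}(\GL (n,\A_E))$ we have" […] p0020:L101 "Thanks to the work of Mœglin and others, a great deal is known about the local representations $\pi_v$ in terms of $\Ar(\pi)$." […] — [MR3135650] = the book (the transfer π ↦ Ar(π) of any discrete π of a quasi-split symplectic / orthogonal G′ to GL(m), with the local results of Mœglin [MR2599005]), every rank ↦ `∀ N, ν.Everything N`; [MR3338302] = Mok's memoir (the same for quasi-split unitary G′) ↦ `∀ N, μ.Everything N`.  Theorem 3.11's other parts (inner forms of GL(n): Jacquet – Langlands / Badulescu; G_2: Kim –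 Shahidi) and the Langlands – Shahidi / Rankin – Selberg inputs: Arthur-free, absorbed; similitude groups via Remark (rem: onlyderived).  Premises: the book (all ranks), Mok (all ranks). [cite: FinisLapid2017Normalizing, §1 (p0003:L51-69), Thm 3.11 (p0015:L148-149), §5 (p0018:L62, p0020:L91-101); Arthur2013, as [MR3135650]; Mok2012, as [MR3338302]] -/
def E_FinisLapidTWN : Prop := (∀ N, ν.Everything N) → (∀ N, μ.Everything N) → c₆₆.FinisLapidTWN

/-- E7 ⇐ MOK ∧ KMSW's node `StabOrdI` — AND NOTHING OF KMSW's SEQUELS (`paper:arxiv-1912.11267`).  THE PLAN: p0004:L3 "The proof of this theorem is based on the endoscopic classification of automorphic representations of $U_{2n}$. More precisely, we choose a unitary group $U_{2n}$ over the maximal totally real subfield $F$ of $E$, an inner form of the quasi-split unitary group $U_{2n}^\ast$ associated to the quadratic extension $E/F$, which has the following properties:" p0004:L5 "* $U_{2n}$ is definite: in other words, $U_{2n}(F \otimes_\bQ \bR)$ is compact." […] p0004:L9 "This group is useful to us for the following reasons. First, the analogue of Ihara's lemma at the place $v$ follows from strong approximation, just as in the case $n = 1$. Second, the endoscopic classification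 implies that the automorphic representations of $U_{2n}(\bA_F)$ should admit a description in terms of the regular algebraic automorphic representations of $\GL_{2n}(\bA_E)$ of unitary type. In particular, the multiplicity of (a descent of) $\pi$ in the space of automorphic forms on $U_{2n}$ should be described by Arthur's multiplicity formula, allowing us to reformulate the problem of level-raising for $\GL_{2n}$ in terms of a more accessible one about level-raising for the group $U_{2n}$."  THE STATUS SENTENCE AND THE AUTHORS' CHOICE: p0004:L11 "We can now explain the reason we must pass to an extension $E' / E$ in the statement of the Theorem (intro_main_theorem): it is there so that the multiplicity on $U_{2n}$ is positive! At the time of writing a proof of the endoscopic classification for groups like $U_{2n}$ (which are inner twists, but not pure inner twists, of the quasi-split form) has been announced by Kaletha, Minguez, Shin, and White [Kal14], but a complete proof has not yet appeared. We therefore establish the small piece of the endoscopic classification that we need using existing references."  §3: p0009:L1-1 "3 The endoscopic classification" p0009:L3 "In this section we prove what we need concerning the endoscopic classification of automorphic representations of certain unitary groups. The results we prove here are a very special case of the general classification, which has been announced in [Kal14]. However, complete results await a sequel to that paper, so we have chosen to give an unconditional proof of what we need here based on existing references." — [Kal14] = Kaletha – Mínguez – Shin – White (the announcement whose completion the authors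 decline to assume).  WHAT THEY USE INSTEAD: p0010:L40 "We continue with the notation and assumptions of the previous section. We now recall some statements in the theory of the twisted trace formula, following [labesse]." […] p0011:L3 "It remains to define the function $\widetilde{f}^H$. By [labesse], the function $f$ admits a transfer $f^H \in C_c^\infty(H(\bA_F))$, which satisfies a certain identity involving the stable orbital integrals of $f^H$. In turn, we may regard $H$ as a principal endoscopic group of the twisted group $\widetilde{M}^H$. By [labesse] (stable transfer), $f^H$ is associated to a function $\widetilde{f}^H \in C_c^\infty(M^H(\bA_F) \rtimes \theta_H)$." […] — [labesse] = J.-P. Labesse, *Changement de base CM et séries discrètes* (Paris book project, 2011): the stabilised trace formula and base change for the unitary group U_m, definite inner forms included — in the register, the ordinary stabilisation for an inner form of U(n) is KMSW's node `StabOrdI` (typed so for Clozel – Thorne II / III = rows C177 / C29, which rest on the same [Lab11] / [CHL11] package) ↦ `κ.StabOrdI`; p0011:L33 "The operator $\mathbf{M}_{Q | \theta(Q)}$ may be expressed, up to analytic continuation, as a product of local unnormalized intertwining operators. Following Shahidi, we can multiply by these local operators by a local factor (defined as in [Mok15]) to obtain normalized intertwining operators. By [Mok15], these are Whittaker normalized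 (see also [Art13]; note that $\tau_0$ is known to be tempered, by [Clo13, Caraianilnotp], so this already follows from the results of [Sha90]). The global renormalized intertwining operator obtained by analytic continuation is" […] p0012:L13 "These choices determine a normalization of local transfer factors satisfying the adelic product formula (see [Kal14] or [Kal19]). This in turn allows us to evaluate the right-hand side of ((eqn_simplified_trace_identity)). More precisely, we first write each twisted trace as a product of local twisted traces. These local twisted traces can be evaluated in terms of stable traces on endoscopic groups of $U_m$, using [Kal14] (a convenient restatement of the results of [Mok15]). These stable traces can then in turned be evaluated in terms of traces on $U_m$ using the endoscopic character identities (thus using again [Kal14] at quasi-split places and [Kal14] or [Kal19] at places $v \in \Sigma$ or $v | \infty$, respectively). We find that if $\sigma = \otimes'_v \sigma_v$ is the irreducible admissible representation of $U_m(\A_F)$ specified up to isomorphism by the following conditions:" […] — [Mok15] = Mok's memoir (Whittaker normalisation of intertwining operators; the local endoscopic character identities for quasi-split unitary groups, « [Kal14] (a convenient restatement of the results of [Mok15]) »), every rank m = 2n ↦ `∀ N, μ.Everything N`.  [Kal19] (Kaletha's rigid normalisation of transfer factors), [Clo11a], [Sha90], [Min11], [Her19], [Caraianilnotp], Taylor –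 Wiles patching on definite unitary groups: published, Arthur-free or within Mok, absorbed.  [Art13] (the book) appears once, « see also », for the Whittaker normalisation: no book premise.  Premises: Mok (all ranks), `StabOrdI`. [cite: AnastassiadesThorne2022, §1 (p0004:L3-11), §3 (p0009:L1-3, p0010:L40, p0011:L3, L33, p0012:L13); Mok2012, as [Mok15]] [claim: KalethaMinguezShinWhite2014, under-review] -/
def E_ATLevelRaising : Prop := (∀ N, μ.Everything N) → κ.StabOrdI → c₆₆.ATLevelRaising

/-- The sixty-sixth tranche of implications. [cite: GrbacShahidi2015, Thm 4.3; JiangZhang2020Nonvanishing, Thm 1.3; Ichino2022ThetaReal, Thm 1.1; FinisLapid2017Normalizing, Thm 3.11; AnastassiadesThorne2022, Thm 1 (each edge's source in its own docstring)] -/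
structure Implications66 : Prop where
  grbacShahidi : E_GrbacShahidiAsai μ c₆₆
  jiangZhang : E_JZUnitaryNonvanishing μ κ c₆₆
  ichino : E_IchinoThetaReal μ κ c₆₆
  finisLapid : E_FinisLapidTWN ν μ c₆₆
  anastassiadesThorne : E_ATLevelRaising μ κ c₆₆

variable {ν μ κ c₆₆}

/-- THE WHOLE TRANCHE GIVEN THE OUTPUTS OF THE THREE DAGS AND KMSW's NODES. [cite: GrbacShahidi2015, Thm 4.3; JiangZhang2020Nonvanishing, Thm 1.3; Ichino2022ThetaReal, Thm 1.1; FinisLapid2017Normalizing, Thm 3.11; AnastassiadesThorne2022, Thm 1 (bookkeeping proved here)] -/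
theorem mokLine_of_rows (Z : Implications66 ν μ κ c₆₆) (hν : ∀ N, ν.Everything N) (hμ : ∀ N, μ.Everything N) (hS : ∀ N, κ.Scope N)
    (hF : ∀ N, κ.Full N) (hO : κ.StabOrdI) :
    c₆₆.GrbacShahidiAsai ∧ c₆₆.JZUnitaryNonvanishing ∧ c₆₆.IchinoThetaReal ∧ c₆₆.FinisLapidTWN ∧ c₆₆.ATLevelRaising :=
  ⟨Z.grbacShahidi hμ, Z.jiangZhang hμ hS, Z.ichino hμ hF, Z.finisLapid hν hμ, Z.anastassiadesThorne hμ hO⟩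

/-- C58, C52, C53, E7 FROM THE PACKAGED INPUTS (no KMSW sequel): Mok's inputs give C58; with KMSW's inputs (its import of Mok, chapter and supply
edges, published leaves) KMSW's proved scope and its node `StabOrdI` follow, giving C52 and E7; with the book's inputs, C53. [cite: GrbacShahidi2015, Thm 4.3; JiangZhang2020Nonvanishing, Thm 1.3; FinisLapid2017Normalizing, Thm 3.11; AnastassiadesThorne2022, Thm 1 (bookkeeping proved here)] -/
theorem mokLine_of_inputs (Z : Implications66 ν μ κ c₆₆) (A : BookInputs ν) (M : MokInputs μ) (K : KMSWInputs μ κ) :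
    c₆₆.GrbacShahidiAsai ∧ c₆₆.JZUnitaryNonvanishing ∧ c₆₆.FinisLapidTWN ∧ c₆₆.ATLevelRaising :=
  ⟨Z.grbacShahidi M.everything, Z.jiangZhang M.everything (KMSWInputs.scope M K), Z.finisLapid A.everything M.everything,
    Z.anastassiadesThorne M.everything (KMSWInputs.stabOrdI K)⟩

/-- C54 FROM THE PACKAGED INPUTS AND KMSW's TWO UNWRITTEN SEQUELS: Ichino's theorem, as typed, needs `κ.Full`, which `KMSWInputs` yield only
together with `κ.UnwrittenSequels` (the sequels [KMS_A], [KMS_B] announced in 2014). [cite: Ichino2022ThetaReal, arXiv:2002.09148 p0003:L45-46 (bookkeeping proved here)] [claim: KalethaMinguezShinWhite2014, under-review] -/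
theorem ichino_of_inputs_and_sequels (Z : Implications66 ν μ κ c₆₆) (M : MokInputs μ) (K : KMSWInputs μ κ) (Q : κ.UnwrittenSequels) :
    c₆₆.IchinoThetaReal :=
  Z.ichino M.everything (KMSWInputs.full M K Q)

/-- THE MOK ROWS IN CONDITIONAL FORM, 2026: granting Mok's section edges, supplies and every PUBLISHED input, and KMSW's import, chapter and supply
edges with every PUBLISHED KMSW input, C58, C52 and E7 follow from Mok's 2024–2026 PREPRINT layer, Mok's two weighted fundamental lemmas and (for
C52, E7) KMSW's general weighted fundamental lemma — none of the three status sentences names the preprint layer or the weighted lemmas (C58 and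
C53 name the twisted stabilisation; E7 names only KMSW's incompleteness, which it indeed does not use). [cite: GrbacShahidi2015, p0003:L43-45; AnastassiadesThorne2022, p0004:L11; JiangZhang2020Nonvanishing, p0003:L24 (bookkeeping proved here)] -/
theorem mokLine_conditional_form (Z : Implications66 ν μ κ c₆₆) (MB : μ.SectionEdges) (MS : μ.SupplyEdges) (MP : μ.PublishedLeaves)
    (D1 : KMSW2014.E_ImportMok μ κ) (KB : κ.ChapterEdges) (KS : κ.SupplyEdges) (KP : κ.PublishedLeaves) :
    μ.PreprintLeaves2026 → μ.WFL_general → μ.WFL_nonstandard → κ.WFL_general →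
      c₆₆.GrbacShahidiAsai ∧ c₆₆.JZUnitaryNonvanishing ∧ c₆₆.ATLevelRaising :=
  fun hQ h6 h7 k6 =>
    have M : MokInputs μ := ⟨MB, MS, MP, hQ, ⟨h6, h7⟩⟩
    have K : KMSWInputs μ κ := ⟨D1, KB, KS, KP, ⟨k6⟩⟩
    ⟨Z.grbacShahidi M.everything, Z.jiangZhang M.everything (KMSWInputs.scope M K),
      Z.anastassiadesThorne M.everything (KMSWInputs.stabOrdI K)⟩

/-- C54 IN CONDITIONAL FORM, 2026: beyond everything `mokLine_conditional_form` grants, Ichino's theorem as typed needs KMSW's two UNWRITTEN SEQUELS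
[KMS_A], [KMS_B] — exactly what its caveat says (« whose proof will be completed in their subsequent work »). [cite: Ichino2022ThetaReal, arXiv:2002.09148 p0003:L46 (bookkeeping proved here)] [claim: KalethaMinguezShinWhite2014, under-review] -/
theorem ichino_conditional_form (Z : Implications66 ν μ κ c₆₆) (MB : μ.SectionEdges) (MS : μ.SupplyEdges) (MP : μ.PublishedLeaves)
    (D1 : KMSW2014.E_ImportMok μ κ) (KB : κ.ChapterEdges) (KS : κ.SupplyEdges) (KP : κ.PublishedLeaves) :
    μ.PreprintLeaves2026 → μ.WFL_general → μ.WFL_nonstandard → κ.WFL_general → κ.KMS_A → κ.KMS_B → c₆₆.IchinoThetaReal :=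
  fun hQ h6 h7 k6 hA hB =>
    have M : MokInputs μ := ⟨MB, MS, MP, hQ, ⟨h6, h7⟩⟩
    have K : KMSWInputs μ κ := ⟨D1, KB, KS, KP, ⟨k6⟩⟩
    ichino_of_inputs_and_sequels Z M K ⟨hA, hB⟩

/-- C53 IN CONDITIONAL FORM, 2026: granting the book's and Mok's edges, supplies and PUBLISHED inputs (the twisted stabilisation and the 2016 list of
prerequisites among them), property (TWN+) for quasi-split classical groups follows from the book's seven PREPRINT leaves and two UNWRITTEN weighted
lemmas and Mok's PREPRINT layer and two weighted lemmas. [cite: FinisLapid2017Normalizing, p0003:L64-67 (bookkeeping proved here)] -/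
theorem finisLapid_conditional_form (Z : Implications66 ν μ κ c₆₆) (B : ν.BookEdges) (S : ν.SupplyEdges) (P : ν.PublishedLeaves)
    (MB : μ.SectionEdges) (MS : μ.SupplyEdges) (MP : μ.PublishedLeaves) :
    ν.PreprintLeaves2026 → ν.UnwrittenLeaves → μ.PreprintLeaves2026 → μ.WFL_general → μ.WFL_nonstandard → c₆₆.FinisLapidTWN :=
  fun Q U hQ h6 h7 => Z.finisLapid (BookInputs.everything ⟨B, S, P, Q, U⟩) (MokInputs.everything ⟨MB, MS, MP, hQ, ⟨h6, h7⟩⟩)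

/-- THE WHOLE TRANCHE FROM THE LEAVES OF THE THREE DAGS AND KMSW's TWO SEQUELS. [cite: GrbacShahidi2015, Thm 4.3; JiangZhang2020Nonvanishing, Thm 1.3; Ichino2022ThetaReal, Thm 1.1; FinisLapid2017Normalizing, Thm 3.11; AnastassiadesThorne2022, Thm 1 (bookkeeping proved here)] -/
theorem mokLine_of_leaves_and_sequels (Z : Implications66 ν μ κ c₆₆) (A : BookInputs ν) (M : MokInputs μ) (K : KMSWInputs μ κ)
    (Q : κ.UnwrittenSequels) :
    c₆₆.GrbacShahidiAsai ∧ c₆₆.JZUnitaryNonvanishing ∧ c₆₆.IchinoThetaReal ∧ c₆₆.FinisLapidTWN ∧ c₆₆.ATLevelRaising :=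
  have h := mokLine_of_inputs Z A M K
  ⟨h.1, h.2.1, ichino_of_inputs_and_sequels Z M K Q, h.2.2.1, h.2.2.2⟩

end Downstream

end Literature.NumberTheory.Automorphic.Arthur2013
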